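import Mathlib
import Literature.NumberTheory.Automorphic.HyperbolicLaplaceSpectrum
import Literature.NumberTheory.Automorphic.RootData

/-!
# Fuchsian groups: the stabiliser of a cusp, Shimizu's lemma, scaling matrices, and Iwaniec's Lemma 2.10
(Iwaniec, *Spectral Methods of Automorphic Forms*, GSM 53, §2.1–2.2 (2.1), §2.4 (2.15)–(2.21),
§2.6 (2.30), (2.34), Lemma 2.10 (2.39), (2.42); §3.1–3.2 (convergence of (3.1), (3.11)); PDF pp. 27–43)

First brick of the theory of cusps for a GENERAL discrete group `Γ ≤ SL₂(ℝ)` (inside `GL₂(ℝ)`, in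
the language of `HyperbolicLaplaceSpectrum.lean`: `IsDiscreteSubgroup Γ`), towards the general
finite-volume cases of the named facts `Iwaniec2002_thm_7_4` (`PretraceEstimate.lean`),
`Iwaniec2002_eq_12_5` (`AutomorphicKernel.lean`) and `Iwaniec2002_thm_12_1`
(`HyperbolicLaplaceSpectrum.lean`), whose modular cases are proved in the tree with `SL₂(ℤ)`-specific
tools (coprime pairs, `ζ`). Chapter 2 of the book states the facts below mostly without proof;
here everything is PROVED (no named facts), from discreteness alone and WITHOUT fundamental
polygons (the standard polygon of §2.2 is replaced by a point of maximal height in the orbit):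

1. (§1) **Shimizu's lemma** `one_le_abs_mul_of_mem`: if `T_h = (1 h; 0 1) ∈ Γ`, `h > 0`, then every
   `(a b; c d) ∈ Γ` has `c = 0` or `|c| h ≥ 1` — the existence of `c_𝔞 > 0` in (2.30) with the
   explicit bound `c_∞ ≥ 1` after scaling (the sequence `γ_{n+1} = γ_n T_h γ_n⁻¹` has
   `c_{n+1} = -c_n² h` and bounded entries).
2. (§2) **The stabiliser of the cusp `∞`**: an upper-triangular element of a discrete `Γ` with `∞`
   a cusp (Mathlib's `IsCusp`) is `± T_x` (no hyperbolic dilations,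
   `eq_upperRightHom_or_neg_of_upperTriangular`); the periods `{x : T_x ∈ Γ}` (Mathlib's
   `Subgroup.strictPeriods`) form a discrete subgroup of `ℝ` (`discreteTopology_strictPeriods`), hence
   `= w ℤ` with the width `w = strictWidthInfty Γ > 0` (`strictWidthInfty_pos`,
   `strictPeriods_eq_zmultiples`), and `Γ_∞ = {± T_{nw}}` (`mem_and_apply_10_eq_zero_iff`) —
   "the stability group of a cusp is an infinite cyclic group generated by a parabolic motion", §2.2.
3. (§3) **Bottom rows and heights**: `rows Γ` (the rows `(c, d)` of `Γ`, `= Γ_∞ \ Γ` up to sign),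
   `rowIm (c, d) z = y/|cz + d|² = Im γz`, the cocycle `rowIm (r γ₀) z = rowIm r (γ₀ z)` and the
   resulting ORBIT INVARIANCE of the count of rows of height `> Y` (`bijOn_vecMul_highRows`).
4. (§4) The spacing property (2.34) of the rows (`rows_spacing`: `c'd - cd' = 0` or `≥ 1` in
   absolute value, from `γ'γ⁻¹ ∈ Γ`), FINITENESS of the rows of height `> Y`
   (`finite_highRows`, translating the upper row into `[0, |c|)`), and a point of MAXIMAL HEIGHT
   in every orbit (`exists_smul_maximal`).
5. (§5) **Lemma 2.10** (`ncard_highRows_le`): for `T_1 ∈ Γ`,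
   `#{rows (c, d) : Im γz > Y} ≤ 2 + 36/Y`, i.e. `#{γ ∈ Γ_∞ \ Γ : Im γz > Y} ≤ 1 + 18/Y` —
   printed `< 1 + 10/(c_𝔞 Y)`; our constant is weaker (dyadic blocks `2^k ≤ |c| < 2^{k+1}`, the
   box principle `card_le_of_separated` for the points `d/c`, at a maximal point of the orbit).
6. (§6) **Convergence of `Σ_{Γ_∞ \ Γ} (Im γz)^σ`, `σ > 1`** (`summable_rowIm_rpow`, with the
   uniform partial-sum bound `sum_rowIm_rpow_le`) — absolute convergence of the Eisenstein and
   Poincaré series (3.1), (3.11) of a general group in `Re s > 1`, by dyadic shells and Lemma 2.10.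
7. (§7) **Scaling matrices** (2.1) (`exists_scaling`): for a cusp `𝔞` of a discrete `Γ ≤ SL₂(ℝ)`
   there is `σ_𝔞 ∈ SL₂(ℝ)`, `σ_𝔞 ∞ = 𝔞`, such that `σ_𝔞⁻¹ Γ σ_𝔞` has periods exactly `ℤ` (so
   `σ_𝔞⁻¹ Γ_𝔞 σ_𝔞 = B`); discreteness and `≤ SL₂(ℝ)` are preserved by conjugation
   (`IsDiscreteSubgroup.conj`, `conj_le_range`), so §§4–6 apply to every cusp after scaling.
   The translations `T_h` and the scaling torus are the tree's one-parameter subgroups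
   `unipotentUpperSL2`, `diagSL2` of `RootData.lean` (`translSL` is an abbreviation).

Not here (next bricks): Lemma 2.11 / Corollary 2.12 (counts of `u(γz, w) < δ`), the invariant
height `y_Γ` beyond the bound `exists_forall_rowIm_le`, finiteness of the number of inequivalent
cusps and the decomposition (2.5) of a fundamental domain for finite covolume (Siegel's theorem,
Props. 2.3–2.5, stated without proof in the book), the double coset decomposition (2.21) as such,
Kloosterman sums.

Mathlib: `IsCusp`, `Matrix.GeneralLinearGroup.upperRightHom`, `Subgroup.strictPeriods`,
`Subgroup.strictWidthInfty(_pos_iff)`, `OnePoint.exists_mem_SL2`, the `GL₂`-action on `OnePoint ℝ`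
(`NumberTheory/ModularForms/Cusps.lean`, `Topology/Compactification/OnePoint/ProjectiveLine.lean`),
`UpperHalfPlane.im_smul_eq_div_normSq`, `ConjAct` pointwise conjugation of subgroups; nothing on
Shimizu's lemma, stabilisers of cusps of non-arithmetic groups, or counting in cusps
(`lean search 'Shimizu|scaling matri|Fuchsian'`: no hits).

## References
* [Iwaniec2002] H. Iwaniec, *Spectral Methods of Automorphic Forms*, 2nd ed., GSM 53, AMS 2002,
  §2.1–2.2, PDF pp. 27–31; §2.4, PDF pp. 33–35; §2.6 (Prop. 2.8, Lemma 2.10, (2.42)), PDF pp. 37–40;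
  §3.1–3.2, PDF pp. 40–43 (held copy `book:iwaniec2002-spectral-methods-automorphic-forms`, pages read).
* Shimizu's lemma: H. Shimizu, *On discontinuous groups operating on the product of the upper half
  planes*, Ann. of Math. 77 (1963), Lemma 4 — standard (e.g. Shimura, *Introduction to the
  Arithmetic Theory of Automorphic Functions*, Lemma 1.7.3); tagged folklore/Iwaniec (2.30) here.
-/

noncomputable section

namespace Literature.NumberTheory.Automorphic

open Matrix UpperHalfPlane
open scoped MatrixGroups

namespace Fuchsian

variable {Γ : Subgroup (GL (Fin 2) ℝ)}

/-! ## 1. Shimizu's lemma -/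

/-- The translation `T_h = (1 h; 0 1) ∈ SL₂(ℝ)`: the tree's upper unipotent one-parameter subgroup
`unipotentUpperSL2` (`RootData.lean`) at `h` (an abbreviation, no new one-parameter subgroup). [folklore] -/
abbrev translSL (h : ℝ) : SL(2, ℝ) := unipotentUpperSL2 (Multiplicative.ofAdd h)

/-- Entry `(0,0)` of `T_h`. [folklore] -/
@[simp] theorem translSL_apply_00 (h : ℝ) : translSL h 0 0 = 1 := rfl
/-- Entry `(0,1)` of `T_h`. [folklore] -/
@[simp] theorem translSL_apply_01 (h : ℝ) : translSL h 0 1 = h := rfl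
/-- Entry `(1,0)` of `T_h`. [folklore] -/
@[simp] theorem translSL_apply_10 (h : ℝ) : translSL h 1 0 = 0 := rfl
/-- Entry `(1,1)` of `T_h`. [folklore] -/
@[simp] theorem translSL_apply_11 (h : ℝ) : translSL h 1 1 = 1 := rfl

/-- `toGL T_h = upperRightHom h`. [folklore] -/
theorem toGL_translSL (h : ℝ) :
    (Matrix.SpecialLinearGroup.toGL (translSL h) : GL (Fin 2) ℝ) =
      Matrix.GeneralLinearGroup.upperRightHom h := by
  ext i j
  fin_cases i <;> fin_cases j <;> rfl

/-- `toGL (-g) = -toGL g`. [folklore] -/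
theorem toGL_neg (g : SL(2, ℝ)) :
    (Matrix.SpecialLinearGroup.toGL (-g) : GL (Fin 2) ℝ) = -Matrix.SpecialLinearGroup.toGL g := by
  ext i j
  simp [Matrix.SpecialLinearGroup.coe_neg]

/-- Entries of the conjugate `g T_h g⁻¹ = (1 - ach, a²h; -c²h, 1 + ach)` for `g = (a b; c d) ∈ SL₂(ℝ)`. [folklore] -/
theorem conj_translSL_apply (g : SL(2, ℝ)) (h : ℝ) :
    (g * translSL h * g⁻¹) 1 0 = -(g 1 0) ^ 2 * h ∧
    (g * translSL h * g⁻¹) 0 1 = (g 0 0) ^ 2 * h ∧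
    (g * translSL h * g⁻¹) 0 0 = 1 - g 0 0 * g 1 0 * h ∧
    (g * translSL h * g⁻¹) 1 1 = 1 + g 0 0 * g 1 0 * h := by
  have hdet : g 0 0 * g 1 1 - g 0 1 * g 1 0 = 1 := by
    have := g.det_coe; rwa [Matrix.det_fin_two] at this
  simp only [Matrix.SpecialLinearGroup.coe_mul, Matrix.SpecialLinearGroup.coe_inv,
    Matrix.adjugate_fin_two, Matrix.mul_apply, Fin.sum_univ_two, Matrix.of_apply, Matrix.cons_val',
    Matrix.cons_val_zero, Matrix.cons_val_one, Matrix.empty_val', Matrix.cons_val_fin_one,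
    translSL_apply_00, translSL_apply_01, translSL_apply_10, translSL_apply_11]
  refine ⟨by ring, by ring, by linear_combination hdet, by linear_combination hdet⟩

/-- Shimizu's sequence `g₀ = g`, `g_{n+1} = g_n T_h g_n⁻¹`. [folklore] -/
def shimizuSeq (g : SL(2, ℝ)) (h : ℝ) : ℕ → SL(2, ℝ)
  | 0 => g
  | n + 1 => shimizuSeq g h n * translSL h * (shimizuSeq g h n)⁻¹

/-- The recursion of Shimizu's sequence. [folklore] -/
theorem shimizuSeq_succ (g : SL(2, ℝ)) (h : ℝ) (n : ℕ) :
    shimizuSeq g h (n + 1) = shimizuSeq g h n * translSL h * (shimizuSeq g h n)⁻¹ := rfl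

/-- Shimizu's sequence stays in `Γ`. [folklore] -/
theorem toGL_shimizuSeq_mem {g : SL(2, ℝ)} {h : ℝ}
    (hg : (Matrix.SpecialLinearGroup.toGL g : GL (Fin 2) ℝ) ∈ Γ)
    (hT : (Matrix.SpecialLinearGroup.toGL (translSL h) : GL (Fin 2) ℝ) ∈ Γ) (n : ℕ) :
    (Matrix.SpecialLinearGroup.toGL (shimizuSeq g h n) : GL (Fin 2) ℝ) ∈ Γ := by
  induction n with
  | zero => exact hg
  | succ n ih =>
    rw [shimizuSeq_succ, map_mul, map_mul, map_inv]
    exact Γ.mul_mem (Γ.mul_mem ih hT) (Γ.inv_mem ih)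

/-- The lower-left entries: `c_{n+1} = -c_n² h`. [folklore] -/
theorem shimizuSeq_c_succ (g : SL(2, ℝ)) (h : ℝ) (n : ℕ) :
    shimizuSeq g h (n + 1) 1 0 = -(shimizuSeq g h n 1 0) ^ 2 * h := by
  rw [shimizuSeq_succ]; exact (conj_translSL_apply _ h).1

/-- `|c_n| h = (|c₀| h)^{2^n}`. [folklore] -/
theorem abs_shimizuSeq_c (g : SL(2, ℝ)) {h : ℝ} (hh : 0 ≤ h) (n : ℕ) :
    |shimizuSeq g h n 1 0| * h = (|g 1 0| * h) ^ (2 ^ n) := by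
  induction n with
  | zero => simp [shimizuSeq]
  | succ n ih =>
    calc |shimizuSeq g h (n + 1) 1 0| * h = (|shimizuSeq g h n 1 0| * h) ^ 2 := by
          rw [shimizuSeq_c_succ, abs_mul, abs_neg, abs_pow, abs_of_nonneg hh]; ring
      _ = (|g 1 0| * h) ^ (2 ^ (n + 1)) := by rw [ih, ← pow_mul, ← pow_succ]

/-- The other entries of Shimizu's sequence. [folklore] -/
theorem shimizuSeq_entries_succ (g : SL(2, ℝ)) (h : ℝ) (n : ℕ) :
    shimizuSeq g h (n + 1) 0 1 = (shimizuSeq g h n 0 0) ^ 2 * h ∧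
    shimizuSeq g h (n + 1) 0 0 = 1 - shimizuSeq g h n 0 0 * shimizuSeq g h n 1 0 * h ∧
    shimizuSeq g h (n + 1) 1 1 = 1 + shimizuSeq g h n 0 0 * shimizuSeq g h n 1 0 * h := by
  rw [shimizuSeq_succ]; exact (conj_translSL_apply _ h).2

/-- If `q = |c₀| h < 1` then `|c_n| h ≤ q` for all `n`. [folklore] -/
theorem abs_shimizuSeq_c_mul_le (g : SL(2, ℝ)) {h : ℝ} (hh : 0 ≤ h) (hq : |g 1 0| * h ≤ 1) (n : ℕ) :
    |shimizuSeq g h n 1 0| * h ≤ |g 1 0| * h := by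
  rw [abs_shimizuSeq_c g hh]
  exact pow_le_of_le_one (by positivity) hq (pow_ne_zero _ two_ne_zero)

/-- Uniform bound for the diagonal entries of Shimizu's sequence. [folklore] -/
theorem abs_shimizuSeq_diag_le (g : SL(2, ℝ)) {h : ℝ} (hh : 0 ≤ h) (hq : |g 1 0| * h < 1) (n : ℕ) :
    |shimizuSeq g h n 0 0| ≤ max (max |g 0 0| |g 1 1|) (1 / (1 - |g 1 0| * h)) ∧
    |shimizuSeq g h n 1 1| ≤ max (max |g 0 0| |g 1 1|) (1 / (1 - |g 1 0| * h)) := by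
  set q : ℝ := |g 1 0| * h with hq_def
  set A : ℝ := max (max |g 0 0| |g 1 1|) (1 / (1 - q)) with hA
  have hq0 : 0 ≤ q := by positivity
  have hA1 : 1 / (1 - q) ≤ A := le_max_right _ _
  have hA0 : 0 ≤ A := le_trans (by positivity) hA1
  have hstep : 1 + A * q ≤ A := by
    have h1 : 1 ≤ A * (1 - q) := by
      rw [one_div] at hA1
      have := (inv_le_iff_one_le_mul₀' (by linarith)).mp hA1
      linarith [this]
    nlinarith
  induction n with
  | zero => exact ⟨le_trans (le_max_left _ _) (le_max_left _ _), le_trans (le_max_right _ _) (le_max_left _ _)⟩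
  | succ n ih =>
    obtain ⟨-, h00, h11⟩ := shimizuSeq_entries_succ g h n
    have hc : |shimizuSeq g h n 1 0| * h ≤ q := abs_shimizuSeq_c_mul_le g hh hq.le n
    have hprod : |shimizuSeq g h n 0 0 * shimizuSeq g h n 1 0 * h| ≤ A * q := by
      rw [abs_mul, abs_mul, abs_of_nonneg hh, mul_assoc]
      exact mul_le_mul ih.1 hc (by positivity) hA0
    constructor
    · rw [h00]
      calc |1 - shimizuSeq g h n 0 0 * shimizuSeq g h n 1 0 * h|
          ≤ |(1 : ℝ)| + |shimizuSeq g h n 0 0 * shimizuSeq g h n 1 0 * h| := abs_sub _ _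
        _ ≤ 1 + A * q := by rw [abs_one]; gcongr
        _ ≤ A := hstep
    · rw [h11]
      calc |1 + shimizuSeq g h n 0 0 * shimizuSeq g h n 1 0 * h|
          ≤ |(1 : ℝ)| + |shimizuSeq g h n 0 0 * shimizuSeq g h n 1 0 * h| := abs_add_le _ _
        _ ≤ 1 + A * q := by rw [abs_one]; gcongr
        _ ≤ A := hstep

/-- Uniform bound for the squared norm of Shimizu's sequence. [folklore] -/
theorem normSq_shimizuSeq_le (g : SL(2, ℝ)) {h : ℝ} (hh : 0 ≤ h) (hq : |g 1 0| * h < 1) (n : ℕ) :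
    (shimizuSeq g h n 0 0) ^ 2 + (shimizuSeq g h n 0 1) ^ 2 + (shimizuSeq g h n 1 0) ^ 2 +
        (shimizuSeq g h n 1 1) ^ 2 ≤
      2 * (max (max |g 0 0| |g 1 1|) (1 / (1 - |g 1 0| * h))) ^ 2 +
        (max |g 0 1| ((max (max |g 0 0| |g 1 1|) (1 / (1 - |g 1 0| * h))) ^ 2 * h)) ^ 2 +
        (g 1 0) ^ 2 := by
  set A : ℝ := max (max |g 0 0| |g 1 1|) (1 / (1 - |g 1 0| * h)) with hA
  have hA0 : 0 ≤ A := le_trans (abs_nonneg _) ((le_max_left _ _).trans (le_max_left _ _))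
  have hdiag := abs_shimizuSeq_diag_le g hh hq n
  have ha : (shimizuSeq g h n 0 0) ^ 2 ≤ A ^ 2 := by
    rw [← sq_abs]; exact pow_le_pow_left₀ (abs_nonneg _) hdiag.1 2
  have hd : (shimizuSeq g h n 1 1) ^ 2 ≤ A ^ 2 := by
    rw [← sq_abs]; exact pow_le_pow_left₀ (abs_nonneg _) hdiag.2 2
  have hc : (shimizuSeq g h n 1 0) ^ 2 ≤ (g 1 0) ^ 2 := by
    by_cases h0 : h = 0
    · cases n with
      | zero => simp [shimizuSeq]
      | succ n => rw [shimizuSeq_c_succ, h0]; simp; positivity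
    · have hpos : 0 < h := lt_of_le_of_ne hh (Ne.symm h0)
      have := abs_shimizuSeq_c_mul_le g hh hq.le n
      have h1 : |shimizuSeq g h n 1 0| ≤ |g 1 0| := le_of_mul_le_mul_right this hpos
      rw [← sq_abs, ← sq_abs (g 1 0)]
      exact pow_le_pow_left₀ (abs_nonneg _) h1 2
  have hb : (shimizuSeq g h n 0 1) ^ 2 ≤ (max |g 0 1| (A ^ 2 * h)) ^ 2 := by
    rw [← sq_abs]
    refine pow_le_pow_left₀ (abs_nonneg _) ?_ 2
    cases n with
    | zero => exact le_max_left _ _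
    | succ n =>
      refine le_trans ?_ (le_max_right _ _)
      rw [(shimizuSeq_entries_succ g h n).1, abs_mul, abs_of_nonneg hh, abs_pow]
      gcongr
      exact (abs_shimizuSeq_diag_le g hh hq n).1
  linarith

/-- **Shimizu's lemma.** Let `Γ ≤ SL₂(ℝ)` (inside `GL₂(ℝ)`) be discrete and contain the
translation `(1 h; 0 1)`, `h > 0`. Then every `γ = (a b; c d) ∈ Γ` has `c = 0` or `|c| h ≥ 1`.
(Proof: if `0 < |c| h < 1`, the sequence `γ₀ = γ`, `γ_{n+1} = γ_n T_h γ_n⁻¹` stays in a norm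
ball and its lower-left entries `c_{n+1} = -c_n² h` are pairwise distinct, contradicting
discreteness.) [cite: Iwaniec2002, §2.6 (2.30)–(2.31) (existence of `c_𝔞`), PDF p. 37; Shimizu's lemma, folklore] -/
theorem one_le_abs_mul_of_mem (hΓ : Γ ≤ (Matrix.SpecialLinearGroup.toGL : SL(2, ℝ) →* GL (Fin 2) ℝ).range)
    (hd : IsDiscreteSubgroup Γ) {h : ℝ} (hh : 0 < h)
    (hT : Matrix.GeneralLinearGroup.upperRightHom h ∈ Γ) {γ : GL (Fin 2) ℝ} (hγ : γ ∈ Γ)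
    (hc : γ 1 0 ≠ 0) : 1 ≤ |γ 1 0| * h := by
  by_contra hlt
  rw [not_le] at hlt
  obtain ⟨g, rfl⟩ := hΓ hγ
  have e : ∀ i j, ((Matrix.SpecialLinearGroup.toGL g : GL (Fin 2) ℝ)) i j = g i j := fun i j => rfl
  simp only [e] at hc hlt
  have hT' : (Matrix.SpecialLinearGroup.toGL (translSL h) : GL (Fin 2) ℝ) ∈ Γ := by
    rwa [toGL_translSL]
  set F : ℕ → GL (Fin 2) ℝ := fun n => Matrix.SpecialLinearGroup.toGL (shimizuSeq g h n) with hF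
  set A : ℝ := max (max |g 0 0| |g 1 1|) (1 / (1 - |g 1 0| * h))
  set r : ℝ := 2 * A ^ 2 + (max |g 0 1| (A ^ 2 * h)) ^ 2 + (g 1 0) ^ 2
  have hsub : Set.range F ⊆ {γ : GL (Fin 2) ℝ | γ ∈ Γ ∧
      (γ 0 0 : ℝ) ^ 2 + (γ 0 1 : ℝ) ^ 2 + (γ 1 0 : ℝ) ^ 2 + (γ 1 1 : ℝ) ^ 2 ≤ r} := by
    rintro _ ⟨n, rfl⟩
    exact ⟨toGL_shimizuSeq_mem hγ hT' n, normSq_shimizuSeq_le g hh.le hlt n⟩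
  have hfin : (Set.range F).Finite := (hd r).subset hsub
  have hq0 : 0 < |g 1 0| * h := mul_pos (abs_pos.mpr hc) hh
  have hanti : StrictAnti fun n : ℕ => (|g 1 0| * h) ^ (2 ^ n) := by
    refine strictAnti_nat_of_succ_lt fun n => ?_
    rw [pow_succ, pow_mul]
    exact pow_lt_self_of_lt_one₀ (by positivity) (pow_lt_one₀ hq0.le hlt (by positivity)) one_lt_two
  have hinj : Function.Injective F := by
    intro m n hmn
    have h1 : shimizuSeq g h m 1 0 = shimizuSeq g h n 1 0 := by
      have := congrArg (fun γ : GL (Fin 2) ℝ => (γ 1 0 : ℝ)) hmn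
      simpa [hF] using this
    have h2 : (|g 1 0| * h) ^ (2 ^ m) = (|g 1 0| * h) ^ (2 ^ n) := by
      rw [← abs_shimizuSeq_c g hh.le, ← abs_shimizuSeq_c g hh.le, h1]
    exact hanti.injective h2
  exact (Set.infinite_range_of_injective hinj) hfin

/-! ## 2. The stabiliser of the cusp `∞` in a discrete group -/

/-- A bounded injective sequence in `Γ` contradicts discreteness. [folklore] -/
theorem _root_.Literature.NumberTheory.Automorphic.IsDiscreteSubgroup.false_of_injective
    (hd : IsDiscreteSubgroup Γ) {F : ℕ → GL (Fin 2) ℝ} (hmem : ∀ n, F n ∈ Γ) {r : ℝ}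
    (hbd : ∀ n, (F n 0 0 : ℝ) ^ 2 + (F n 0 1 : ℝ) ^ 2 + (F n 1 0 : ℝ) ^ 2 + (F n 1 1 : ℝ) ^ 2 ≤ r)
    (hinj : Function.Injective F) : False := by
  have hsub : Set.range F ⊆ {γ : GL (Fin 2) ℝ | γ ∈ Γ ∧
      (γ 0 0 : ℝ) ^ 2 + (γ 0 1 : ℝ) ^ 2 + (γ 1 0 : ℝ) ^ 2 + (γ 1 1 : ℝ) ^ 2 ≤ r} := by
    rintro _ ⟨n, rfl⟩; exact ⟨hmem n, hbd n⟩
  exact (Set.infinite_range_of_injective hinj) ((hd r).subset hsub)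

/-- Entry `(0,0)` of `T_x = upperRightHom x`. [folklore] -/
@[simp] theorem upperRightHom_apply_00 (x : ℝ) :
    (Matrix.GeneralLinearGroup.upperRightHom x : GL (Fin 2) ℝ) 0 0 = 1 := rfl
/-- Entry `(0,1)` of `T_x = upperRightHom x`. [folklore] -/
@[simp] theorem upperRightHom_apply_01 (x : ℝ) :
    (Matrix.GeneralLinearGroup.upperRightHom x : GL (Fin 2) ℝ) 0 1 = x := rfl
/-- Entry `(1,0)` of `T_x = upperRightHom x`. [folklore] -/
@[simp] theorem upperRightHom_apply_10 (x : ℝ) :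
    (Matrix.GeneralLinearGroup.upperRightHom x : GL (Fin 2) ℝ) 1 0 = 0 := rfl
/-- Entry `(1,1)` of `T_x = upperRightHom x`. [folklore] -/
@[simp] theorem upperRightHom_apply_11 (x : ℝ) :
    (Matrix.GeneralLinearGroup.upperRightHom x : GL (Fin 2) ℝ) 1 1 = 1 := rfl

/-- Translations `T_{u^n x}`, `0 < |u| < 1`, `x ≠ 0`, cannot all lie in a discrete group. [folklore] -/
theorem _root_.Literature.NumberTheory.Automorphic.IsDiscreteSubgroup.false_of_upperRightHom_pow_mem
    (hd : IsDiscreteSubgroup Γ) {u x : ℝ} (hu0 : u ≠ 0) (hu1 : |u| < 1) (hx : x ≠ 0)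
    (hmem : ∀ n : ℕ, Matrix.GeneralLinearGroup.upperRightHom (u ^ n * x) ∈ Γ) : False := by
  refine hd.false_of_injective hmem (r := 2 + x ^ 2) (fun n => ?_) ?_
  · simp only [upperRightHom_apply_00, upperRightHom_apply_01, upperRightHom_apply_10,
      upperRightHom_apply_11]
    have h1 : |u ^ n * x| ≤ |x| := by
      rw [abs_mul, abs_pow]
      exact mul_le_of_le_one_left (abs_nonneg x) (pow_le_one₀ (abs_nonneg u) hu1.le)
    have h2 : (u ^ n * x) ^ 2 ≤ x ^ 2 := by
      rw [← sq_abs, ← sq_abs x]; exact pow_le_pow_left₀ (abs_nonneg _) h1 2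
    linarith
  · intro m n hmn
    have h1 : u ^ m * x = u ^ n * x := by
      have := congrArg (fun γ : GL (Fin 2) ℝ => (γ 0 1 : ℝ)) hmn
      simpa using this
    have h2 : |u| ^ m = |u| ^ n := by
      rw [← abs_pow, ← abs_pow, mul_right_cancel₀ hx h1]
    exact pow_right_injective₀ (abs_pos.mpr hu0) hu1.ne h2

/-- Conjugating a translation by an upper-triangular `g = (a b; 0 d) ∈ SL₂(ℝ)`:
`g T_x g⁻¹ = T_{a² x}`. [folklore] -/
theorem toGL_conj_upperRightHom {g : SL(2, ℝ)} (hg : g 1 0 = 0) (x : ℝ) :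
    (Matrix.SpecialLinearGroup.toGL g : GL (Fin 2) ℝ) * Matrix.GeneralLinearGroup.upperRightHom x *
        (Matrix.SpecialLinearGroup.toGL g : GL (Fin 2) ℝ)⁻¹ =
      Matrix.GeneralLinearGroup.upperRightHom ((g 0 0) ^ 2 * x) := by
  rw [← toGL_translSL, ← map_mul, ← map_inv, ← map_mul, ← toGL_translSL]
  congr 1
  obtain ⟨h10, h01, h00, h11⟩ := conj_translSL_apply g x
  rw [hg] at h10 h00 h11
  ext i j
  fin_cases i <;> fin_cases j
  · simpa using h00
  · simpa using h01
  · simpa using h10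
  · simpa using h11

/-- Iterating: `g^n T_x g^{-n} = T_{a^{2n} x} ∈ Γ`. [folklore] -/
theorem upperRightHom_pow_mul_mem {g : SL(2, ℝ)} (hg : g 1 0 = 0)
    (hgΓ : (Matrix.SpecialLinearGroup.toGL g : GL (Fin 2) ℝ) ∈ Γ) {x : ℝ}
    (hx : Matrix.GeneralLinearGroup.upperRightHom x ∈ Γ) (n : ℕ) :
    Matrix.GeneralLinearGroup.upperRightHom (((g 0 0) ^ 2) ^ n * x) ∈ Γ := by
  induction n with
  | zero => simpa using hx
  | succ n ih =>
    have := Γ.mul_mem (Γ.mul_mem hgΓ ih) (Γ.inv_mem hgΓ)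
    rw [toGL_conj_upperRightHom hg] at this
    convert this using 2
    ring

/-- From a cusp at `∞` one gets a translation `T_h ∈ Γ` with `h > 0`. [folklore] -/
theorem exists_upperRightHom_mem_of_isCusp
    (hΓ : Γ ≤ (Matrix.SpecialLinearGroup.toGL : SL(2, ℝ) →* GL (Fin 2) ℝ).range)
    (hinf : IsCusp OnePoint.infty Γ) :
    ∃ h : ℝ, 0 < h ∧ Matrix.GeneralLinearGroup.upperRightHom h ∈ Γ := by
  obtain ⟨p, hpΓ, hpar, hfix⟩ := hinf
  rw [OnePoint.smul_infty_eq_self_iff] at hfix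
  have hdet : p.det = 1 ∨ p.det = -1 := by
    obtain ⟨g, rfl⟩ := hΓ hpΓ
    left; ext; simp
  rcases (Matrix.GeneralLinearGroup.isParabolic_iff_of_upperTriangular_of_det hdet hfix).mp hpar with
    ⟨x, hx, rfl⟩ | ⟨x, hx, hp⟩
  · rcases lt_or_gt_of_ne hx with hneg | hpos
    · refine ⟨-x, by linarith, ?_⟩
      have := Γ.inv_mem hpΓ
      rwa [← AddChar.map_neg_eq_inv] at this
    · exact ⟨x, hpos, hpΓ⟩
  · have h2 : Matrix.GeneralLinearGroup.upperRightHom (x + x) ∈ Γ := by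
      rw [AddChar.map_add_eq_mul]
      have := Γ.mul_mem hpΓ hpΓ
      rwa [hp, neg_mul_neg] at this
    rcases lt_or_gt_of_ne hx with hneg | hpos
    · refine ⟨-(x + x), by linarith, ?_⟩
      have := Γ.inv_mem h2
      rwa [← AddChar.map_neg_eq_inv] at this
    · exact ⟨x + x, by linarith, h2⟩

/-- **The stabiliser of a cusp in a discrete group contains no hyperbolic element**: if `∞` is a
cusp of the discrete group `Γ ≤ SL₂(ℝ)`, every upper-triangular `γ ∈ Γ` is `± T_x`
(Iwaniec §2.2: "the stability group of a cusp is an infinite cyclic group generated by a parabolic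
motion"). [cite: Iwaniec2002, §2.2, PDF pp. 29–30] -/
theorem eq_upperRightHom_or_neg_of_upperTriangular
    (hΓ : Γ ≤ (Matrix.SpecialLinearGroup.toGL : SL(2, ℝ) →* GL (Fin 2) ℝ).range)
    (hd : IsDiscreteSubgroup Γ) (hinf : IsCusp OnePoint.infty Γ) {γ : GL (Fin 2) ℝ} (hγ : γ ∈ Γ)
    (hc : γ 1 0 = 0) :
    ∃ x : ℝ, γ = Matrix.GeneralLinearGroup.upperRightHom x ∨
      γ = -Matrix.GeneralLinearGroup.upperRightHom x := by
  obtain ⟨h, hh, hT⟩ := exists_upperRightHom_mem_of_isCusp hΓ hinf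
  obtain ⟨g, rfl⟩ := hΓ hγ
  have e : ∀ i j, ((Matrix.SpecialLinearGroup.toGL g : GL (Fin 2) ℝ)) i j = g i j := fun i j => rfl
  rw [e] at hc
  have hdet : g 0 0 * g 1 1 = 1 := by
    have := g.det_coe; rw [Matrix.det_fin_two, hc] at this; linarith
  have ha0 : g 0 0 ≠ 0 := fun h0 => by rw [h0, zero_mul] at hdet; exact zero_ne_one hdet
  have hd0 : g 1 1 ≠ 0 := fun h0 => by rw [h0, mul_zero] at hdet; exact zero_ne_one hdet
  -- `|a| = 1`
  have habs : |g 0 0| = 1 := by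
    by_contra hne
    rcases lt_or_gt_of_ne hne with hlt | hgt
    · -- `|a| < 1`: the translations `T_{a^{2n} h}` accumulate
      refine hd.false_of_upperRightHom_pow_mem (u := (g 0 0) ^ 2) (x := h) (pow_ne_zero 2 ha0)
        ?_ hh.ne' (upperRightHom_pow_mul_mem hc hγ hT)
      rw [abs_pow, sq_lt_one_iff₀ (abs_nonneg _)]; exact hlt
    · -- `|a| > 1`: use `g⁻¹ = (d -b; 0 a)` with `|d| < 1`
      have hc' : g⁻¹ 1 0 = 0 := by
        simp [Matrix.SpecialLinearGroup.coe_inv, Matrix.adjugate_fin_two, hc]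
      have h00' : g⁻¹ 0 0 = g 1 1 := by
        simp [Matrix.SpecialLinearGroup.coe_inv, Matrix.adjugate_fin_two]
      have hγ' : (Matrix.SpecialLinearGroup.toGL g⁻¹ : GL (Fin 2) ℝ) ∈ Γ := by
        rw [map_inv]; exact Γ.inv_mem hγ
      have hdlt : |g 1 1| < 1 := by
        have h1 : |g 0 0| * |g 1 1| = 1 := by rw [← abs_mul, hdet, abs_one]
        by_contra hge
        rw [not_lt] at hge
        have : 1 < |g 0 0| * |g 1 1| := by nlinarith [abs_nonneg (g 1 1)]
        linarith
      refine hd.false_of_upperRightHom_pow_mem (u := (g⁻¹ 0 0) ^ 2) (x := h)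
        (pow_ne_zero 2 (by rw [h00']; exact hd0)) ?_ hh.ne' (upperRightHom_pow_mul_mem hc' hγ' hT)
      rw [h00', abs_pow, sq_lt_one_iff₀ (abs_nonneg _)]; exact hdlt
  have hda : g 1 1 = g 0 0 := by
    rcases abs_eq (zero_le_one) |>.mp habs with h1 | h1 <;>
    · rw [h1] at hdet ⊢; linarith
  refine ⟨g 0 0 * g 0 1, ?_⟩
  rcases abs_eq (zero_le_one) |>.mp habs with h1 | h1
  · left
    ext i j
    rw [e]
    fin_cases i <;> fin_cases j <;> simp [h1, hc, hda]
  · right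
    ext i j
    rw [show ((-Matrix.GeneralLinearGroup.upperRightHom (g 0 0 * g 0 1) : GL (Fin 2) ℝ)) i j =
      -((Matrix.GeneralLinearGroup.upperRightHom (g 0 0 * g 0 1) : GL (Fin 2) ℝ) i j) from rfl, e]
    fin_cases i <;> fin_cases j <;> simp [h1, hc, hda]

/-- A subgroup of the image of `SL₂(ℝ)` has determinant one. [folklore] -/
theorem hasDetOne_of_le
    (hΓ : Γ ≤ (Matrix.SpecialLinearGroup.toGL : SL(2, ℝ) →* GL (Fin 2) ℝ).range) :
    Γ.HasDetOne :=
  ⟨fun {g} hg => by obtain ⟨g, rfl⟩ := hΓ hg; ext; simp⟩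

/-- The nonzero periods of absolute value `≤ 1` of a discrete group form a finite set. [folklore] -/
theorem finite_periods_le_one (hd : IsDiscreteSubgroup Γ) :
    {x : ℝ | Matrix.GeneralLinearGroup.upperRightHom x ∈ Γ ∧ x ≠ 0 ∧ |x| ≤ 1}.Finite := by
  refine ((hd 3).image (fun γ : GL (Fin 2) ℝ => (γ 0 1 : ℝ))).subset ?_
  rintro x ⟨hx, -, h1⟩
  refine ⟨_, ⟨hx, ?_⟩, rfl⟩
  have : x ^ 2 ≤ 1 := by rw [← sq_abs]; exact pow_le_one₀ (abs_nonneg _) h1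
  simp only [upperRightHom_apply_00, upperRightHom_apply_01, upperRightHom_apply_10,
    upperRightHom_apply_11]
  linarith

/-- **The periods of a discrete group form a discrete subgroup of `ℝ`.** [folklore] -/
theorem discreteTopology_strictPeriods (hd : IsDiscreteSubgroup Γ) :
    DiscreteTopology Γ.strictPeriods := by
  have hfin := finite_periods_le_one hd
  obtain ⟨r, hr0, hr1, hr⟩ : ∃ r : ℝ, 0 < r ∧ r ≤ 1 ∧
      ∀ x ∈ {x : ℝ | Matrix.GeneralLinearGroup.upperRightHom x ∈ Γ ∧ x ≠ 0 ∧ |x| ≤ 1}, r ≤ |x| := by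
    rcases hfin.toFinset.eq_empty_or_nonempty with h | h
    · refine ⟨1, one_pos, le_rfl, fun x hx => ?_⟩
      have := hfin.mem_toFinset.mpr hx
      rw [h] at this
      simp at this
    · obtain ⟨x₀, hx₀, hmin⟩ := hfin.toFinset.exists_min_image (fun x => |x|) h
      exact ⟨min 1 |x₀|, lt_min one_pos (abs_pos.mpr (hfin.mem_toFinset.mp hx₀).2.1),
        min_le_left _ _, fun x hx => (min_le_right _ _).trans (hmin x (hfin.mem_toFinset.mpr hx))⟩
  refine DiscreteTopology.of_forall_le_dist hr0 ?_
  intro p q hpq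
  by_contra hlt
  rw [not_le, Subtype.dist_eq, Real.dist_eq] at hlt
  have hmem : Matrix.GeneralLinearGroup.upperRightHom ((p : ℝ) - q) ∈ Γ :=
    Subgroup.mem_strictPeriods_iff.mp (Γ.strictPeriods.sub_mem p.2 q.2)
  have hne : (p : ℝ) - q ≠ 0 := sub_ne_zero.mpr fun h => hpq (Subtype.ext h)
  have := hr _ ⟨hmem, hne, by linarith⟩
  linarith

/-- **The width of the cusp `∞` is positive** (the stabiliser is infinite cyclic generated by a
parabolic motion). [cite: Iwaniec2002, §2.2 (2.1), PDF p. 30] -/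
theorem strictWidthInfty_pos
    (hΓ : Γ ≤ (Matrix.SpecialLinearGroup.toGL : SL(2, ℝ) →* GL (Fin 2) ℝ).range)
    (hd : IsDiscreteSubgroup Γ) (hinf : IsCusp OnePoint.infty Γ) : 0 < Γ.strictWidthInfty := by
  haveI := discreteTopology_strictPeriods hd
  haveI := hasDetOne_of_le hΓ
  exact Subgroup.strictWidthInfty_pos_iff.mpr hinf

/-- The periods are the integral multiples of the width. [cite: Iwaniec2002, §2.2 (2.1), PDF p. 30] -/
theorem strictPeriods_eq_zmultiples (hd : IsDiscreteSubgroup Γ) :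
    Γ.strictPeriods = AddSubgroup.zmultiples Γ.strictWidthInfty := by
  haveI := discreteTopology_strictPeriods hd
  exact Subgroup.strictPeriods_eq_zmultiples_strictWidthInfty

/-- **The stabiliser `Γ_∞` of the cusp `∞`** in a discrete group `Γ ≤ SL₂(ℝ)` containing `-1`:
`Γ_∞ = {± (1 nw; 0 1) : n ∈ ℤ}`, `w > 0` the width (Iwaniec (2.1): after scaling,
`σ_𝔞⁻¹ Γ_𝔞 σ_𝔞 = B`). [cite: Iwaniec2002, §2.2 (2.1) & §2.4 (2.15), PDF pp. 30, 34] -/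
theorem mem_and_apply_10_eq_zero_iff
    (hΓ : Γ ≤ (Matrix.SpecialLinearGroup.toGL : SL(2, ℝ) →* GL (Fin 2) ℝ).range)
    (hneg : -1 ∈ Γ) (hd : IsDiscreteSubgroup Γ) (hinf : IsCusp OnePoint.infty Γ) (γ : GL (Fin 2) ℝ) :
    (γ ∈ Γ ∧ γ 1 0 = 0) ↔ ∃ n : ℤ,
      γ = Matrix.GeneralLinearGroup.upperRightHom (n * Γ.strictWidthInfty) ∨
        γ = -Matrix.GeneralLinearGroup.upperRightHom (n * Γ.strictWidthInfty) := by
  constructor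
  · rintro ⟨hγ, hc⟩
    obtain ⟨x, hx⟩ := eq_upperRightHom_or_neg_of_upperTriangular hΓ hd hinf hγ hc
    have hxP : x ∈ Γ.strictPeriods := by
      rw [Subgroup.mem_strictPeriods_iff]
      rcases hx with rfl | rfl
      · exact hγ
      · have := Γ.mul_mem hneg hγ
        rwa [mul_neg, neg_mul, one_mul, neg_neg] at this
    rw [strictPeriods_eq_zmultiples hd, AddSubgroup.mem_zmultiples_iff] at hxP
    obtain ⟨n, rfl⟩ := hxP
    exact ⟨n, by simpa [zsmul_eq_mul] using hx⟩
  · rintro ⟨n, hn⟩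
    have hmem : Matrix.GeneralLinearGroup.upperRightHom (n * Γ.strictWidthInfty) ∈ Γ := by
      rw [← Subgroup.mem_strictPeriods_iff, strictPeriods_eq_zmultiples hd,
        AddSubgroup.mem_zmultiples_iff]
      exact ⟨n, by simp [zsmul_eq_mul]⟩
    rcases hn with rfl | rfl
    · exact ⟨hmem, rfl⟩
    · refine ⟨?_, ?_⟩
      · have := Γ.mul_mem hneg hmem
        rwa [neg_mul, one_mul] at this
      · show -((Matrix.GeneralLinearGroup.upperRightHom (n * Γ.strictWidthInfty) : GL (Fin 2) ℝ) 1 0) = 0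
        simp

/-! ## 3. Bottom rows and the height function `Im γz` -/

/-- The set of bottom rows `(c, d)` of the elements of `Γ` (in bijection with `Γ_∞ \\ Γ` up to the
sign when `-1 ∈ Γ`: two elements with proportional rows differ by `± T_x` on the left, see
`rows_spacing`). [cite: Iwaniec2002, §2.4, PDF pp. 34–35] -/
def rows (Γ : Subgroup (GL (Fin 2) ℝ)) : Set (Fin 2 → ℝ) :=
  (fun γ : GL (Fin 2) ℝ => (γ : Matrix (Fin 2) (Fin 2) ℝ) 1) '' (Γ : Set (GL (Fin 2) ℝ))

/-- The bottom row of an element of `Γ` is a row of `Γ`. [folklore] -/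
theorem row_mem_rows {γ : GL (Fin 2) ℝ} (hγ : γ ∈ Γ) : (γ : Matrix (Fin 2) (Fin 2) ℝ) 1 ∈ rows Γ :=
  ⟨γ, hγ, rfl⟩

/-- Membership in `rows Γ`. [folklore] -/
theorem mem_rows_iff {r : Fin 2 → ℝ} : r ∈ rows Γ ↔ ∃ γ ∈ Γ, (γ : Matrix (Fin 2) (Fin 2) ℝ) 1 = r :=
  Iff.rfl

/-- A bottom row of an invertible matrix is nonzero. [folklore] -/
theorem ne_zero_of_mem_rows {r : Fin 2 → ℝ} (hr : r ∈ rows Γ) : r ≠ 0 := by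
  obtain ⟨γ, -, rfl⟩ := hr
  intro h
  have hdet := Matrix.GeneralLinearGroup.det_ne_zero γ
  rw [show γ.val = (γ : Matrix (Fin 2) (Fin 2) ℝ) from rfl, Matrix.det_fin_two,
    show (γ : Matrix (Fin 2) (Fin 2) ℝ) 1 0 = 0 from congr_fun h 0,
    show (γ : Matrix (Fin 2) (Fin 2) ℝ) 1 1 = 0 from congr_fun h 1] at hdet
  simp at hdet

/-- The linear form `c z + d` of a row `r = (c, d)`. [folklore] -/
def rowDenom (r : Fin 2 → ℝ) (z : ℍ) : ℂ := (r 0 : ℂ) * z + r 1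

/-- **The height** `Im γz = y / |cz + d|²` as a function of the bottom row `(c, d)` of `γ`.
[cite: Iwaniec2002, §2.6 (proof of Lemma 2.10), PDF p. 39] -/
def rowIm (r : Fin 2 → ℝ) (z : ℍ) : ℝ := z.im / Complex.normSq (rowDenom r z)

/-- `|cz + d|² = (cx + d)² + c²y²`. [folklore] -/
theorem normSq_rowDenom (r : Fin 2 → ℝ) (z : ℍ) :
    Complex.normSq (rowDenom r z) = (r 0 * z.re + r 1) ^ 2 + (r 0 * z.im) ^ 2 := by
  rw [rowDenom, Complex.normSq_apply]
  simp; ring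

/-- `cz + d ≠ 0` for `(c, d) ≠ 0`, `z ∈ ℍ`. [folklore] -/
theorem rowDenom_ne_zero {r : Fin 2 → ℝ} (hr : r ≠ 0) (z : ℍ) : rowDenom r z ≠ 0 := by
  have := UpperHalfPlane.linear_ne_zero z hr
  simpa [rowDenom] using this

/-- `|cz + d|² > 0` for `(c, d) ≠ 0`. [folklore] -/
theorem normSq_rowDenom_pos {r : Fin 2 → ℝ} (hr : r ≠ 0) (z : ℍ) : 0 < Complex.normSq (rowDenom r z) :=
  Complex.normSq_pos.mpr (rowDenom_ne_zero hr z)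

/-- The height of a nonzero row is positive. [folklore] -/
theorem rowIm_pos {r : Fin 2 → ℝ} (hr : r ≠ 0) (z : ℍ) : 0 < rowIm r z :=
  div_pos z.im_pos (normSq_rowDenom_pos hr z)

/-- The height is nonnegative (it is `0` for the zero row by the junk value `y/0 = 0`). [folklore] -/
theorem rowIm_nonneg (r : Fin 2 → ℝ) (z : ℍ) : 0 ≤ rowIm r z :=
  div_nonneg z.im_pos.le (Complex.normSq_nonneg _)

/-- `Im γz = rowIm (row γ) z` for `γ ∈ SL₂(ℝ)`. [folklore] -/
theorem im_smul_eq_rowIm {γ : GL (Fin 2) ℝ}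
    (hγ : γ ∈ (Matrix.SpecialLinearGroup.toGL : SL(2, ℝ) →* GL (Fin 2) ℝ).range) (z : ℍ) :
    (γ • z).im = rowIm ((γ : Matrix (Fin 2) (Fin 2) ℝ) 1) z := by
  obtain ⟨g, rfl⟩ := hγ
  rw [UpperHalfPlane.im_smul_eq_div_normSq, rowIm]
  have : |((Matrix.SpecialLinearGroup.toGL g : GL (Fin 2) ℝ)).det.val| = 1 := by simp
  rw [this, one_mul]
  rfl

/-- The row `(0, 1)` of the identity has height `Im z`. [folklore] -/
theorem rowIm_row_one (z : ℍ) :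
    rowIm (((1 : GL (Fin 2) ℝ) : Matrix (Fin 2) (Fin 2) ℝ) 1) z = z.im := by
  rw [rowIm, rowDenom]
  simp

/-- The bottom row of a product is the bottom row times the matrix. [folklore] -/
theorem row_mul (γ γ₀ : GL (Fin 2) ℝ) :
    ((γ * γ₀ : GL (Fin 2) ℝ) : Matrix (Fin 2) (Fin 2) ℝ) 1 =
      Matrix.vecMul ((γ : Matrix (Fin 2) (Fin 2) ℝ) 1) (γ₀ : Matrix (Fin 2) (Fin 2) ℝ) := by
  ext j
  simp [Matrix.mul_apply, Matrix.vecMul, dotProduct, Fin.sum_univ_two]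

/-- `rows Γ` is stable under right multiplication by `γ₀ ∈ Γ`. [folklore] -/
theorem vecMul_mem_rows {r : Fin 2 → ℝ} (hr : r ∈ rows Γ) {γ₀ : GL (Fin 2) ℝ} (hγ₀ : γ₀ ∈ Γ) :
    Matrix.vecMul r (γ₀ : Matrix (Fin 2) (Fin 2) ℝ) ∈ rows Γ := by
  obtain ⟨γ, hγ, rfl⟩ := hr
  exact ⟨γ * γ₀, Γ.mul_mem hγ hγ₀, row_mul γ γ₀⟩

/-- `r γ₀` is a row of `Γ` iff `r` is, for `γ₀ ∈ Γ`. [folklore] -/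
theorem vecMul_mem_rows_iff {r : Fin 2 → ℝ} {γ₀ : GL (Fin 2) ℝ} (hγ₀ : γ₀ ∈ Γ) :
    Matrix.vecMul r (γ₀ : Matrix (Fin 2) (Fin 2) ℝ) ∈ rows Γ ↔ r ∈ rows Γ := by
  refine ⟨fun h => ?_, fun h => vecMul_mem_rows h hγ₀⟩
  have := vecMul_mem_rows h (Γ.inv_mem hγ₀)
  rwa [Matrix.vecMul_vecMul, ← Units.val_mul, mul_inv_cancel, Units.val_one, Matrix.vecMul_one] at this

/-- The cocycle relation `(cz + d)` for the row `r γ₀` at `z` equals `(c w + d) · j(γ₀, z)` with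
`w = γ₀ z`. [folklore] -/
theorem rowDenom_vecMul {γ₀ : GL (Fin 2) ℝ} (hγ₀ : 0 < γ₀.det.val) (r : Fin 2 → ℝ) (z : ℍ) :
    rowDenom (Matrix.vecMul r (γ₀ : Matrix (Fin 2) (Fin 2) ℝ)) z =
      rowDenom r (γ₀ • z) * UpperHalfPlane.denom γ₀ z := by
  have hd : UpperHalfPlane.denom γ₀ z ≠ 0 := UpperHalfPlane.denom_ne_zero γ₀ z
  simp only [rowDenom]
  rw [UpperHalfPlane.coe_smul_of_det_pos hγ₀]
  field_simp
  simp only [Matrix.vecMul, dotProduct, Fin.sum_univ_two, UpperHalfPlane.num, UpperHalfPlane.denom,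
    Complex.ofReal_add, Complex.ofReal_mul]
  ring

/-- **Orbit relation for heights**: `rowIm (r γ₀) z = rowIm r (γ₀ z)` for `γ₀ ∈ SL₂(ℝ)`. [folklore] -/
theorem rowIm_vecMul {γ₀ : GL (Fin 2) ℝ}
    (hγ₀ : γ₀ ∈ (Matrix.SpecialLinearGroup.toGL : SL(2, ℝ) →* GL (Fin 2) ℝ).range)
    (r : Fin 2 → ℝ) (z : ℍ) :
    rowIm (Matrix.vecMul r (γ₀ : Matrix (Fin 2) (Fin 2) ℝ)) z = rowIm r (γ₀ • z) := by
  have hdet : γ₀.det.val = 1 := by obtain ⟨g, rfl⟩ := hγ₀; simp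
  have hpos : 0 < γ₀.det.val := by rw [hdet]; exact one_pos
  rw [rowIm, rowIm, rowDenom_vecMul hpos, Complex.normSq_mul, UpperHalfPlane.im_smul_eq_div_normSq,
    hdet, abs_one, one_mul]
  have hn : Complex.normSq (UpperHalfPlane.denom γ₀ z) ≠ 0 :=
    Complex.normSq_pos.mpr (UpperHalfPlane.denom_ne_zero γ₀ z) |>.ne'
  by_cases h0 : Complex.normSq (rowDenom r (γ₀ • z)) = 0
  · rw [h0, zero_mul, div_zero, div_zero]
  · field_simp

/-- The set of rows of height `> Y` at `z`. [cite: Iwaniec2002, Lemma 2.10, PDF p. 38] -/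
def highRows (Γ : Subgroup (GL (Fin 2) ℝ)) (z : ℍ) (Y : ℝ) : Set (Fin 2 → ℝ) :=
  {r | r ∈ rows Γ ∧ Y < rowIm r z}

/-- **Orbit invariance of the count**: right multiplication by `γ₀ ∈ Γ` is a bijection from the
high rows at `γ₀ z` onto the high rows at `z`. [cite: Iwaniec2002, proof of Lemma 2.10 ("we may
assume that `z ∈ F`"), PDF p. 39] -/
theorem bijOn_vecMul_highRows
    (hΓ : Γ ≤ (Matrix.SpecialLinearGroup.toGL : SL(2, ℝ) →* GL (Fin 2) ℝ).range)
    {γ₀ : GL (Fin 2) ℝ} (hγ₀ : γ₀ ∈ Γ) (z : ℍ) (Y : ℝ) :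
    Set.BijOn (fun r => Matrix.vecMul r (γ₀ : Matrix (Fin 2) (Fin 2) ℝ)) (highRows Γ (γ₀ • z) Y)
      (highRows Γ z Y) := by
  refine ⟨fun r hr => ⟨vecMul_mem_rows hr.1 hγ₀, by rw [rowIm_vecMul (hΓ hγ₀)]; exact hr.2⟩, ?_, ?_⟩
  · intro r _ r' _ h
    have := congrArg (fun v => Matrix.vecMul v ((γ₀⁻¹ : GL (Fin 2) ℝ) : Matrix (Fin 2) (Fin 2) ℝ)) h
    simpa only [Matrix.vecMul_vecMul, ← Units.val_mul, mul_inv_cancel, Units.val_one,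
      Matrix.vecMul_one] using this
  · intro r hr
    refine ⟨Matrix.vecMul r ((γ₀⁻¹ : GL (Fin 2) ℝ) : Matrix (Fin 2) (Fin 2) ℝ), ⟨?_, ?_⟩, ?_⟩
    · exact vecMul_mem_rows hr.1 (Γ.inv_mem hγ₀)
    · rw [rowIm_vecMul (hΓ (Γ.inv_mem hγ₀)), ← mul_smul, inv_mul_cancel, one_smul]; exact hr.2
    · simp only [Matrix.vecMul_vecMul, ← Units.val_mul, inv_mul_cancel, Units.val_one,
        Matrix.vecMul_one]

/-- The number of high rows is constant along orbits. [cite: Iwaniec2002, proof of Lemma 2.10, PDF p. 39] -/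
theorem ncard_highRows_smul
    (hΓ : Γ ≤ (Matrix.SpecialLinearGroup.toGL : SL(2, ℝ) →* GL (Fin 2) ℝ).range)
    {γ₀ : GL (Fin 2) ℝ} (hγ₀ : γ₀ ∈ Γ) (z : ℍ) (Y : ℝ) :
    (highRows Γ (γ₀ • z) Y).ncard = (highRows Γ z Y).ncard :=
  (bijOn_vecMul_highRows hΓ hγ₀ z Y).ncard_eq

/-- Finiteness of the high rows is constant along orbits. [folklore] -/
theorem finite_highRows_smul_iff
    (hΓ : Γ ≤ (Matrix.SpecialLinearGroup.toGL : SL(2, ℝ) →* GL (Fin 2) ℝ).range)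
    {γ₀ : GL (Fin 2) ℝ} (hγ₀ : γ₀ ∈ Γ) (z : ℍ) (Y : ℝ) :
    (highRows Γ (γ₀ • z) Y).Finite ↔ (highRows Γ z Y).Finite :=
  (bijOn_vecMul_highRows hΓ hγ₀ z Y).finite_iff_finite

/-! ## 4. Finiteness of the high rows and points of maximal height -/

section WidthOne

/-- `T = T_1 ∈ Γ` makes `∞` a cusp. [folklore] -/
theorem isCusp_infty_of_mem (hT : Matrix.GeneralLinearGroup.upperRightHom (1 : ℝ) ∈ Γ) :
    IsCusp OnePoint.infty Γ :=
  Subgroup.isCusp_of_mem_strictPeriods one_pos (Subgroup.mem_strictPeriods_iff.mpr hT)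

/-- Integral translations lie in `Γ` once `T_1` does. [folklore] -/
theorem upperRightHom_intCast_mem (hT : Matrix.GeneralLinearGroup.upperRightHom (1 : ℝ) ∈ Γ) (n : ℤ) :
    Matrix.GeneralLinearGroup.upperRightHom (n : ℝ) ∈ Γ := by
  have := Γ.strictPeriods.zsmul_mem (Subgroup.mem_strictPeriods_iff.mpr hT) n
  rw [zsmul_eq_mul, mul_one] at this
  exact Subgroup.mem_strictPeriods_iff.mp this

/-- **Shimizu for rows** (width one at `∞`): a bottom row `(c, d)` of `Γ` has `c = 0` or `|c| ≥ 1`,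
i.e. `c_∞ ≥ 1` in (2.30). [cite: Iwaniec2002, (2.30), PDF p. 37] -/
theorem one_le_abs_of_mem_rows
    (hΓ : Γ ≤ (Matrix.SpecialLinearGroup.toGL : SL(2, ℝ) →* GL (Fin 2) ℝ).range)
    (hd : IsDiscreteSubgroup Γ) (hT : Matrix.GeneralLinearGroup.upperRightHom (1 : ℝ) ∈ Γ)
    {r : Fin 2 → ℝ} (hr : r ∈ rows Γ) (h0 : r 0 ≠ 0) : 1 ≤ |r 0| := by
  obtain ⟨γ, hγ, rfl⟩ := hr
  have := one_le_abs_mul_of_mem hΓ hd one_pos hT hγ h0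
  rwa [mul_one] at this

/-- Rows with `c = 0` are `(0, ±1)` (width one at `∞`). [cite: Iwaniec2002, §2.4 (2.16)–(2.17), PDF pp. 34–35] -/
theorem apply_one_eq_of_mem_rows
    (hΓ : Γ ≤ (Matrix.SpecialLinearGroup.toGL : SL(2, ℝ) →* GL (Fin 2) ℝ).range)
    (hd : IsDiscreteSubgroup Γ) (hT : Matrix.GeneralLinearGroup.upperRightHom (1 : ℝ) ∈ Γ)
    {r : Fin 2 → ℝ} (hr : r ∈ rows Γ) (h0 : r 0 = 0) : r 1 = 1 ∨ r 1 = -1 := by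
  obtain ⟨γ, hγ, rfl⟩ := hr
  obtain ⟨x, hx | hx⟩ :=
    eq_upperRightHom_or_neg_of_upperTriangular hΓ hd (isCusp_infty_of_mem hT) hγ h0
  · left; rw [hx]; rfl
  · right; rw [hx]; rfl

/-- Entries of `T_t g`. [folklore] -/
theorem translSL_mul_apply (t : ℝ) (g : SL(2, ℝ)) :
    (translSL t * g) 0 0 = g 0 0 + t * g 1 0 ∧ (translSL t * g) 0 1 = g 0 1 + t * g 1 1 ∧
      (translSL t * g) 1 0 = g 1 0 ∧ (translSL t * g) 1 1 = g 1 1 := by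
  simp only [Matrix.SpecialLinearGroup.coe_mul, Matrix.mul_apply, Fin.sum_univ_two, translSL_apply_00,
    translSL_apply_01, translSL_apply_10, translSL_apply_11]
  refine ⟨by ring, by ring, by ring, by ring⟩

/-- The spacing property (2.34)–(2.35) behind all counting: two rows `(c, d)`, `(c', d')` of `Γ`
have `c'd - cd' = 0` or `|c'd - cd'| ≥ 1` (it is the lower-left entry of `γ'γ⁻¹ ∈ Γ`), and in
the first case the rows agree up to sign. [cite: Iwaniec2002, proof of Prop. 2.8 (2.34), PDF p. 38] -/
theorem rows_spacing
    (hΓ : Γ ≤ (Matrix.SpecialLinearGroup.toGL : SL(2, ℝ) →* GL (Fin 2) ℝ).range)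
    (hd : IsDiscreteSubgroup Γ) (hT : Matrix.GeneralLinearGroup.upperRightHom (1 : ℝ) ∈ Γ)
    {r r' : Fin 2 → ℝ} (hr : r ∈ rows Γ) (hr' : r' ∈ rows Γ) :
    (r' 0 * r 1 - r 0 * r' 1 = 0 ∧ (r' = r ∨ r' = -r)) ∨ 1 ≤ |r' 0 * r 1 - r 0 * r' 1| := by
  obtain ⟨γ, hγ, rfl⟩ := hr
  obtain ⟨γ', hγ', rfl⟩ := hr'
  obtain ⟨g, rfl⟩ := hΓ hγ
  obtain ⟨g', rfl⟩ := hΓ hγ'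
  have hmem : (Matrix.SpecialLinearGroup.toGL (g' * g⁻¹) : GL (Fin 2) ℝ) ∈ Γ := by
    rw [map_mul, map_inv]; exact Γ.mul_mem hγ' (Γ.inv_mem hγ)
  have e : ∀ (h : SL(2, ℝ)) i j, ((Matrix.SpecialLinearGroup.toGL h : GL (Fin 2) ℝ) : Matrix (Fin 2) (Fin 2) ℝ) i j = h i j :=
    fun h i j => rfl
  have h10 : (g' * g⁻¹) 1 0 = g' 1 0 * g 1 1 - g 1 0 * g' 1 1 := by
    simp [Matrix.mul_apply, Fin.sum_univ_two, Matrix.SpecialLinearGroup.coe_inv, Matrix.adjugate_fin_two]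
    ring
  simp only [e]
  by_cases hc : (g' * g⁻¹) 1 0 = 0
  · left
    refine ⟨by rw [← h10, hc], ?_⟩
    obtain ⟨x, hx | hx⟩ :=
      eq_upperRightHom_or_neg_of_upperTriangular hΓ hd (isCusp_infty_of_mem hT) hmem hc
    · left
      have : g' = translSL x * g := by
        have h1 : Matrix.SpecialLinearGroup.toGL (g' * g⁻¹) = Matrix.SpecialLinearGroup.toGL (translSL x) := by
          rw [hx, toGL_translSL]
        have := Matrix.SpecialLinearGroup.toGL_injective h1
        rw [← this, inv_mul_cancel_right]
      obtain ⟨-, -, h10', h11'⟩ := translSL_mul_apply x g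
      ext j
      fin_cases j
      · show g' 1 0 = g 1 0
        rw [this]; exact h10'
      · show g' 1 1 = g 1 1
        rw [this]; exact h11'
    · right
      have : g' = -(translSL x * g) := by
        have h1 : Matrix.SpecialLinearGroup.toGL (g' * g⁻¹) =
            Matrix.SpecialLinearGroup.toGL (-translSL x) := by
          rw [hx, toGL_neg, toGL_translSL]
        have := Matrix.SpecialLinearGroup.toGL_injective h1
        rw [← neg_mul, ← this, inv_mul_cancel_right]
      obtain ⟨-, -, h10', h11'⟩ := translSL_mul_apply x g
      ext j
      fin_cases j
      · show g' 1 0 = -(g 1 0)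
        rw [this, Matrix.SpecialLinearGroup.coe_neg, Matrix.neg_apply, h10']
      · show g' 1 1 = -(g 1 1)
        rw [this, Matrix.SpecialLinearGroup.coe_neg, Matrix.neg_apply, h11']
  · right
    have := one_le_abs_mul_of_mem hΓ hd one_pos hT hmem hc
    rw [mul_one] at this
    show 1 ≤ |g' 1 0 * g 1 1 - g 1 0 * g' 1 1|
    rwa [← h10]

/-- Height bound: a high row `(c, d)` has `c² < 1/(yY)` and `(cx + d)² < y/Y`. [cite: Iwaniec2002, proof of Lemma 2.10, PDF p. 39] -/
theorem sq_lt_of_mem_highRows {z : ℍ} {Y : ℝ} (hY : 0 < Y) {r : Fin 2 → ℝ}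
    (hr : r ∈ highRows Γ z Y) :
    Complex.normSq (rowDenom r z) < z.im / Y ∧ (r 0) ^ 2 < 1 / (z.im * Y) ∧
      (r 0 * z.re + r 1) ^ 2 < z.im / Y := by
  have hr0 : r ≠ 0 := ne_zero_of_mem_rows hr.1
  have hn : 0 < Complex.normSq (rowDenom r z) := normSq_rowDenom_pos hr0 z
  have hy : 0 < z.im := z.im_pos
  have h1 : Complex.normSq (rowDenom r z) < z.im / Y := by
    have := hr.2
    rw [rowIm, lt_div_iff₀ hn] at this
    rw [lt_div_iff₀ hY]; linarith
  refine ⟨h1, ?_, ?_⟩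
  · rw [normSq_rowDenom] at h1
    have h2 : (r 0 * z.im) ^ 2 < z.im / Y := by nlinarith [sq_nonneg (r 0 * z.re + r 1)]
    rw [lt_div_iff₀ (mul_pos hy hY)]
    rw [lt_div_iff₀ hY] at h2
    nlinarith
  · rw [normSq_rowDenom] at h1
    nlinarith [sq_nonneg (r 0 * z.im)]

/-- **Finiteness**: for every `z` and `Y > 0` only finitely many rows of `Γ` have height `> Y` at
`z` (translate the upper-left entry into `[0, |c|)` and use discreteness). [cite: Iwaniec2002, Lemma 2.10, PDF p. 38] -/
theorem finite_highRows
    (hΓ : Γ ≤ (Matrix.SpecialLinearGroup.toGL : SL(2, ℝ) →* GL (Fin 2) ℝ).range)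
    (hd : IsDiscreteSubgroup Γ) (hT : Matrix.GeneralLinearGroup.upperRightHom (1 : ℝ) ∈ Γ)
    (z : ℍ) {Y : ℝ} (hY : 0 < Y) : (highRows Γ z Y).Finite := by
  set P : ℝ := 1 / (z.im * Y) with hP
  set Q : ℝ := 2 * (z.im / Y) + 2 * (z.re ^ 2 * P) with hQ
  set R : ℝ := 2 * P + 2 * (P * Q) + 2 + Q with hR
  have hfin := (hd R).image (fun γ : GL (Fin 2) ℝ => (γ : Matrix (Fin 2) (Fin 2) ℝ) 1)
  have hfin0 : ({![(0 : ℝ), 1], ![(0 : ℝ), -1]} : Set (Fin 2 → ℝ)).Finite := by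
    exact Set.toFinite _
  refine (hfin.union hfin0).subset ?_
  intro r hr
  obtain ⟨hnorm, hc2, hcd2⟩ := sq_lt_of_mem_highRows hY hr
  by_cases h0 : r 0 = 0
  · right
    rcases apply_one_eq_of_mem_rows hΓ hd hT hr.1 h0 with h1 | h1
    · left; ext j; fin_cases j <;> simp [h0, h1]
    · right; ext j; fin_cases j <;> simp [h0, h1]
  · left
    obtain ⟨γ, hγ, hrow⟩ := hr.1
    obtain ⟨g, rfl⟩ := hΓ hγ
    have e : ∀ (h : SL(2, ℝ)) i j, ((Matrix.SpecialLinearGroup.toGL h : GL (Fin 2) ℝ) : Matrix (Fin 2) (Fin 2) ℝ) i j = h i j :=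
      fun h i j => rfl
    have hc : g 1 0 = r 0 := by rw [← hrow]; rfl
    have hdd : g 1 1 = r 1 := by rw [← hrow]; rfl
    -- translate the top row
    set n : ℤ := ⌊g 0 0 / g 1 0⌋ with hn
    obtain ⟨h00, h01, h10, h11⟩ := translSL_mul_apply (-(n : ℝ)) g
    have hmem : (Matrix.SpecialLinearGroup.toGL (translSL (-(n : ℝ)) * g) : GL (Fin 2) ℝ) ∈ Γ := by
      rw [map_mul, toGL_translSL]
      exact Γ.mul_mem (by simpa using upperRightHom_intCast_mem hT (-n)) hγ
    generalize translSL (-(n : ℝ)) * g = g' at h00 h01 h10 h11 hmem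
    refine ⟨Matrix.SpecialLinearGroup.toGL g', ⟨hmem, ?_⟩, ?_⟩
    · -- the norm bound
      have hc0 : g 1 0 ≠ 0 := by rw [hc]; exact h0
      have hc1 : 1 ≤ (g 1 0) ^ 2 := by
        have := one_le_abs_of_mem_rows hΓ hd hT hr.1 h0
        rw [← hc] at this
        nlinarith [abs_nonneg (g 1 0), sq_abs (g 1 0)]
      have ha' : g' 0 0 = g 1 0 * Int.fract (g 0 0 / g 1 0) := by
        rw [h00, Int.fract, hn]; field_simp; ring
      have ha'2 : (g' 0 0) ^ 2 ≤ (g 1 0) ^ 2 := by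
        rw [ha', mul_pow]
        have hf0 := Int.fract_nonneg (g 0 0 / g 1 0)
        have hf1 := Int.fract_lt_one (g 0 0 / g 1 0)
        have : (Int.fract (g 0 0 / g 1 0)) ^ 2 ≤ 1 := by nlinarith
        nlinarith [sq_nonneg (g 1 0)]
      have hdet : g' 0 0 * g 1 1 - g' 0 1 * g 1 0 = 1 := by
        have := g'.det_coe; rw [Matrix.det_fin_two, h10, h11] at this; linarith
      have hb' : (g' 0 1) ^ 2 ≤ (g' 0 0 * g 1 1 - 1) ^ 2 := by
        have e1 : g' 0 1 = (g' 0 0 * g 1 1 - 1) / g 1 0 := by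
          field_simp; linarith
        rw [e1, div_pow]
        exact div_le_self (sq_nonneg _) hc1
      have hcP : (g 1 0) ^ 2 < P := by rw [hc]; exact hc2
      have hdQ : (g 1 1) ^ 2 < Q := by
        rw [hdd]
        have : (r 1) ^ 2 ≤ 2 * (r 0 * z.re + r 1) ^ 2 + 2 * (z.re ^ 2 * (r 0) ^ 2) := by
          nlinarith [sq_nonneg (r 0 * z.re + r 1 + r 0 * z.re)]
        have h3 : z.re ^ 2 * (r 0) ^ 2 ≤ z.re ^ 2 * P :=
          mul_le_mul_of_nonneg_left hc2.le (sq_nonneg _)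
        rw [hQ]; nlinarith
      have hP0 : 0 ≤ P := by rw [hP]; positivity
      have had : (g' 0 0) ^ 2 * (g 1 1) ^ 2 ≤ P * Q :=
        mul_le_mul (ha'2.trans hcP.le) hdQ.le (sq_nonneg _) hP0
      have hb'2 : (g' 0 1) ^ 2 ≤ 2 * (P * Q) + 2 := by
        refine hb'.trans ?_
        have : (g' 0 0 * g 1 1 - 1) ^ 2 ≤ 2 * ((g' 0 0) ^ 2 * (g 1 1) ^ 2) + 2 := by
          nlinarith [sq_nonneg (g' 0 0 * g 1 1 + 1)]
        linarith
      have ha'P : (g' 0 0) ^ 2 ≤ P := ha'2.trans hcP.le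
      simp only [e]
      rw [h10, h11, hR]
      linarith
    · -- the row is unchanged
      rw [← hrow]
      ext j
      fin_cases j
      · exact h10
      · exact h11

/-- **A point of maximal height in every orbit**: for every `z` there is `γ₀ ∈ Γ` such that
`w = γ₀ z` satisfies `Im γ w ≤ Im w` for all `γ ∈ Γ` (this replaces "we may assume `z ∈ F`, the
standard polygon" in Iwaniec's proof). [cite: Iwaniec2002, §2.2 (2.6) & proof of Lemma 2.10, PDF pp. 31, 39] -/
theorem exists_smul_maximal
    (hΓ : Γ ≤ (Matrix.SpecialLinearGroup.toGL : SL(2, ℝ) →* GL (Fin 2) ℝ).range)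
    (hd : IsDiscreteSubgroup Γ) (hT : Matrix.GeneralLinearGroup.upperRightHom (1 : ℝ) ∈ Γ) (z : ℍ) :
    ∃ γ₀ ∈ Γ, ∀ r ∈ rows Γ, rowIm r (γ₀ • z) ≤ (γ₀ • z).im := by
  have hfin := finite_highRows hΓ hd hT z (half_pos z.im_pos)
  have hne : (hfin.toFinset).Nonempty := by
    refine ⟨((1 : GL (Fin 2) ℝ) : Matrix (Fin 2) (Fin 2) ℝ) 1, hfin.mem_toFinset.mpr ⟨row_mem_rows Γ.one_mem, ?_⟩⟩
    rw [rowIm_row_one]; linarith [z.im_pos]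
  obtain ⟨r₀, hr₀, hmax⟩ := hfin.toFinset.exists_max_image (fun r => rowIm r z) hne
  obtain ⟨⟨γ₀, hγ₀, rfl⟩, hr₀Y⟩ := hfin.mem_toFinset.mp hr₀
  refine ⟨γ₀, hγ₀, fun r hr => ?_⟩
  rw [im_smul_eq_rowIm (hΓ hγ₀), ← rowIm_vecMul (hΓ hγ₀)]
  have hr' : Matrix.vecMul r (γ₀ : Matrix (Fin 2) (Fin 2) ℝ) ∈ rows Γ := vecMul_mem_rows hr hγ₀
  by_cases hlt : z.im / 2 < rowIm (Matrix.vecMul r (γ₀ : Matrix (Fin 2) (Fin 2) ℝ)) z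
  · exact hmax _ (hfin.mem_toFinset.mpr ⟨hr', hlt⟩)
  · rw [not_lt] at hlt
    exact hlt.trans hr₀Y.le

end WidthOne

/-! ## 5. Iwaniec's Lemma 2.10: counting the cosets `Γ_∞ γ` with `Im γz > Y` -/

/-- **Box principle on the line**: a finite set of reals with pairwise distances `≥ δ` contains
two points at distance `≥ (#T - 1) δ`. [folklore] -/
theorem exists_pair_of_separated {T : Finset ℝ} {δ : ℝ}
    (hsep : ∀ p ∈ T, ∀ q ∈ T, p ≠ q → δ ≤ |p - q|) (hne : T.Nonempty) :
    ∃ p ∈ T, ∃ q ∈ T, ((T.card : ℝ) - 1) * δ ≤ p - q := by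
  induction T using Finset.induction_on_max with
  | empty => exact absurd hne Finset.not_nonempty_empty
  | insert a s ha ih =>
    have has : a ∉ s := fun h => lt_irrefl a (ha a h)
    rcases s.eq_empty_or_nonempty with rfl | hs
    · exact ⟨a, by simp, a, by simp, by simp⟩
    · have hsep' : ∀ p ∈ s, ∀ q ∈ s, p ≠ q → δ ≤ |p - q| := fun p hp q hq =>
        hsep p (Finset.mem_insert_of_mem hp) q (Finset.mem_insert_of_mem hq)
      obtain ⟨p₀, hp₀, q₀, hq₀, hle⟩ := ih hsep' hs
      have hap : δ ≤ a - p₀ := by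
        have := hsep a (Finset.mem_insert_self a s) p₀ (Finset.mem_insert_of_mem hp₀) (ha p₀ hp₀).ne'
        rwa [abs_of_pos (sub_pos.mpr (ha p₀ hp₀))] at this
      refine ⟨a, Finset.mem_insert_self a s, q₀, Finset.mem_insert_of_mem hq₀, ?_⟩
      rw [Finset.card_insert_of_notMem has]
      push_cast
      linarith

/-- A finite set of reals of diameter `≤ L` with pairwise distances `≥ δ > 0` has at most
`L/δ + 1` elements. [cite: Iwaniec2002, proof of Prop. 2.8 ("the box principle"), PDF p. 38] -/
theorem card_le_of_separated {T : Finset ℝ} {δ L : ℝ} (hδ : 0 < δ) (hL : 0 ≤ L)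
    (hsep : ∀ p ∈ T, ∀ q ∈ T, p ≠ q → δ ≤ |p - q|) (hdiam : ∀ p ∈ T, ∀ q ∈ T, p - q ≤ L) :
    (T.card : ℝ) ≤ L / δ + 1 := by
  rcases T.eq_empty_or_nonempty with rfl | hne
  · simp; positivity
  · obtain ⟨p, hp, q, hq, hle⟩ := exists_pair_of_separated hsep hne
    have h1 : ((T.card : ℝ) - 1) * δ ≤ L := hle.trans (hdiam p hp q hq)
    have h2 : (T.card : ℝ) - 1 ≤ L / δ := by rw [le_div_iff₀ hδ]; exact h1
    linarith

section Counting

variable (Γ)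

/-- The high rows `(c, d)` with `c` of sign `s` (auxiliary for the count). [folklore] -/
def signedHighRows (z : ℍ) (Y s : ℝ) : Set (Fin 2 → ℝ) :=
  {r | r ∈ highRows Γ z Y ∧ 0 < s * r 0}

/-- The dyadic block `2^k ≤ |c| < 2^{k+1}` of the signed high rows (the ranges `C ≤ c < 2C` of
the printed proof). [cite: Iwaniec2002, proof of Lemma 2.10, PDF p. 39] -/
def block (z : ℍ) (Y s : ℝ) (k : ℕ) : Set (Fin 2 → ℝ) :=
  {r | r ∈ signedHighRows Γ z Y s ∧ (2 : ℝ) ^ k ≤ |r 0| ∧ |r 0| < (2 : ℝ) ^ (k + 1)}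

variable {Γ}

/-- A signed row has `c ≠ 0`. [folklore] -/
theorem apply_zero_ne_zero_of_mem_signedHighRows {z : ℍ} {Y s : ℝ} {r : Fin 2 → ℝ}
    (hr : r ∈ signedHighRows Γ z Y s) : r 0 ≠ 0 := by
  intro h; have := hr.2; rw [h, mul_zero] at this; exact lt_irrefl 0 this

/-- The fractions `d/c` separate the signed high rows. [cite: Iwaniec2002, proof of Prop. 2.8 & Lemma 2.10, PDF pp. 38–39] -/
theorem injOn_frac
    (hΓ : Γ ≤ (Matrix.SpecialLinearGroup.toGL : SL(2, ℝ) →* GL (Fin 2) ℝ).range)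
    (hd : IsDiscreteSubgroup Γ) (hT : Matrix.GeneralLinearGroup.upperRightHom (1 : ℝ) ∈ Γ)
    (z : ℍ) (Y s : ℝ) :
    Set.InjOn (fun r : Fin 2 → ℝ => r 1 / r 0) (signedHighRows Γ z Y s) := by
  intro r hr r' hr' h
  have hr0 := apply_zero_ne_zero_of_mem_signedHighRows hr
  have hr'0 := apply_zero_ne_zero_of_mem_signedHighRows hr'
  simp only at h
  have hcross : r' 0 * r 1 - r 0 * r' 1 = 0 := by
    field_simp at h
    linarith
  rcases rows_spacing hΓ hd hT hr.1.1 hr'.1.1 with ⟨-, h1 | h1⟩ | h1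
  · exact h1.symm
  · exfalso
    have h2 : r' 0 = -r 0 := by rw [h1]; rfl
    have := hr'.2
    rw [h2, mul_neg] at this
    linarith [hr.2]
  · rw [hcross, abs_zero] at h1; linarith

/-- Spacing of the fractions within a dyadic block: `|d/c - d'/c'| ≥ 1/(cc') > 4^{-(k+1)}`.
[cite: Iwaniec2002, (2.34), PDF p. 38] -/
theorem frac_separated
    (hΓ : Γ ≤ (Matrix.SpecialLinearGroup.toGL : SL(2, ℝ) →* GL (Fin 2) ℝ).range)
    (hd : IsDiscreteSubgroup Γ) (hT : Matrix.GeneralLinearGroup.upperRightHom (1 : ℝ) ∈ Γ)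
    (z : ℍ) (Y s : ℝ) (k : ℕ) {r r' : Fin 2 → ℝ}
    (hr : r ∈ block Γ z Y s k) (hr' : r' ∈ block Γ z Y s k) (hne : r ≠ r') :
    ((4 : ℝ) ^ (k + 1))⁻¹ ≤ |r 1 / r 0 - r' 1 / r' 0| := by
  have hr0 := apply_zero_ne_zero_of_mem_signedHighRows hr.1
  have hr'0 := apply_zero_ne_zero_of_mem_signedHighRows hr'.1
  have hfrac : r 1 / r 0 ≠ r' 1 / r' 0 := fun h => hne (injOn_frac hΓ hd hT z Y s hr.1 hr'.1 h)
  have hcross : r' 0 * r 1 - r 0 * r' 1 ≠ 0 := by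
    intro h0
    apply hfrac
    field_simp
    linarith
  have h1 : 1 ≤ |r' 0 * r 1 - r 0 * r' 1| := by
    rcases rows_spacing hΓ hd hT hr.1.1.1 hr'.1.1.1 with ⟨h, -⟩ | h
    · exact absurd h hcross
    · exact h
  have e : r 1 / r 0 - r' 1 / r' 0 = (r' 0 * r 1 - r 0 * r' 1) / (r 0 * r' 0) := by
    field_simp
  rw [e, abs_div, abs_mul, le_div_iff₀ (by positivity)]
  have h2 : |r 0| * |r' 0| < (4 : ℝ) ^ (k + 1) := by
    have e4 : (4 : ℝ) ^ (k + 1) = 2 ^ (k + 1) * 2 ^ (k + 1) := by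
      rw [← mul_pow]; norm_num
    rw [e4]
    exact mul_lt_mul'' hr.2.2 hr'.2.2 (abs_nonneg _) (abs_nonneg _)
  calc ((4 : ℝ) ^ (k + 1))⁻¹ * (|r 0| * |r' 0|) ≤ ((4 : ℝ) ^ (k + 1))⁻¹ * (4 : ℝ) ^ (k + 1) := by
        gcongr
    _ = 1 := inv_mul_cancel₀ (by positivity)
    _ ≤ _ := h1

/-- Localisation of the fractions: `|x + d/c| < (y/Y)^{1/2} / 2^k` in the block `k`.
[cite: Iwaniec2002, proof of Lemma 2.10 ("`|cx + d| < y^{1/2} Y^{-1/2}`"), PDF p. 39] -/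
theorem abs_re_add_frac_lt {z : ℍ} {Y : ℝ} (hY : 0 < Y) {s : ℝ} {k : ℕ} {r : Fin 2 → ℝ}
    (hr : r ∈ block Γ z Y s k) : |z.re + r 1 / r 0| < Real.sqrt (z.im / Y) / (2 : ℝ) ^ k := by
  have hr0 := apply_zero_ne_zero_of_mem_signedHighRows hr.1
  obtain ⟨-, -, hsq⟩ := sq_lt_of_mem_highRows hY hr.1.1
  have h1 : |r 0 * z.re + r 1| < Real.sqrt (z.im / Y) := by
    refine abs_lt_of_sq_lt_sq ?_ (Real.sqrt_nonneg _)
    rwa [Real.sq_sqrt (by positivity)]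
  have e : z.re + r 1 / r 0 = (r 0 * z.re + r 1) / r 0 := by field_simp
  rw [e, abs_div, div_lt_div_iff₀ (abs_pos.mpr hr0) (by positivity)]
  calc |r 0 * z.re + r 1| * (2 : ℝ) ^ k < Real.sqrt (z.im / Y) * (2 : ℝ) ^ k := by gcongr
    _ ≤ Real.sqrt (z.im / Y) * |r 0| := by gcongr; exact hr.2.1

/-- **The count in a dyadic block**: `#{rows in block k} ≤ 8 · 2^k (y/Y)^{1/2} + 1`.
[cite: Iwaniec2002, proof of Lemma 2.10, PDF p. 39] -/
theorem ncard_block_le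
    (hΓ : Γ ≤ (Matrix.SpecialLinearGroup.toGL : SL(2, ℝ) →* GL (Fin 2) ℝ).range)
    (hd : IsDiscreteSubgroup Γ) (hT : Matrix.GeneralLinearGroup.upperRightHom (1 : ℝ) ∈ Γ)
    (z : ℍ) {Y : ℝ} (hY : 0 < Y) (s : ℝ) (k : ℕ) :
    (block Γ z Y s k).Finite ∧
      ((block Γ z Y s k).ncard : ℝ) ≤ 8 * (2 : ℝ) ^ k * Real.sqrt (z.im / Y) + 1 := by
  have hfin : (block Γ z Y s k).Finite :=
    (finite_highRows hΓ hd hT z hY).subset fun r hr => hr.1.1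
  refine ⟨hfin, ?_⟩
  set φ : (Fin 2 → ℝ) → ℝ := fun r => r 1 / r 0 with hφ
  have hinj : Set.InjOn φ (block Γ z Y s k) := (injOn_frac hΓ hd hT z Y s).mono fun r hr => hr.1
  have hcard : (hfin.toFinset.image φ).card = (block Γ z Y s k).ncard := by
    rw [Finset.card_image_of_injOn (by simpa using hinj), Set.ncard_eq_toFinset_card _ hfin]
  rw [← hcard]
  have hA : 0 ≤ Real.sqrt (z.im / Y) := Real.sqrt_nonneg _
  have key := card_le_of_separated (T := hfin.toFinset.image φ) (δ := ((4 : ℝ) ^ (k + 1))⁻¹)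
    (L := 2 * (Real.sqrt (z.im / Y) / (2 : ℝ) ^ k)) (by positivity) (by positivity) ?_ ?_
  · refine key.trans_eq ?_
    rw [div_inv_eq_mul, pow_succ, show (4 : ℝ) ^ k = 2 ^ k * 2 ^ k by rw [← mul_pow]; norm_num]
    field_simp
    ring
  · intro p hp q hq hpq
    simp only [Finset.mem_image, Set.Finite.mem_toFinset] at hp hq
    obtain ⟨r, hr, rfl⟩ := hp
    obtain ⟨r', hr', rfl⟩ := hq
    exact frac_separated hΓ hd hT z Y s k hr hr' (fun h => hpq (by rw [h]))
  · intro p hp q hq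
    simp only [Finset.mem_image, Set.Finite.mem_toFinset] at hp hq
    obtain ⟨r, hr, rfl⟩ := hp
    obtain ⟨r', hr', rfl⟩ := hq
    have h1 := abs_re_add_frac_lt hY hr
    have h2 := abs_re_add_frac_lt hY hr'
    simp only [hφ]
    rw [abs_lt] at h1 h2
    linarith [h1.2, h2.1]

end Counting

section Counting2

/-- Every signed high row lies in a dyadic block `k` with `2^k ≤ |c|`. [folklore] -/
theorem exists_mem_block
    (hΓ : Γ ≤ (Matrix.SpecialLinearGroup.toGL : SL(2, ℝ) →* GL (Fin 2) ℝ).range)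
    (hd : IsDiscreteSubgroup Γ) (hT : Matrix.GeneralLinearGroup.upperRightHom (1 : ℝ) ∈ Γ)
    {z : ℍ} {Y s : ℝ} {r : Fin 2 → ℝ} (hr : r ∈ signedHighRows Γ z Y s) :
    ∃ k : ℕ, r ∈ block Γ z Y s k := by
  have hr0 := apply_zero_ne_zero_of_mem_signedHighRows hr
  have h1 : 1 ≤ |r 0| := one_le_abs_of_mem_rows hΓ hd hT hr.1.1 hr0
  have hex : ∃ k : ℕ, |r 0| < (2 : ℝ) ^ (k + 1) := by
    obtain ⟨k, hk⟩ := pow_unbounded_of_one_lt |r 0| (one_lt_two (α := ℝ))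
    exact ⟨k, hk.trans_le (pow_le_pow_right₀ one_le_two (Nat.le_succ k))⟩
  classical
  refine ⟨Nat.find hex, hr, ?_, Nat.find_spec hex⟩
  rcases Nat.eq_zero_or_pos (Nat.find hex) with h0 | hpos
  · rw [h0, pow_zero]; exact h1
  · have := Nat.find_min hex (m := Nat.find hex - 1) (Nat.sub_lt hpos one_pos)
    have h2 : Nat.find hex - 1 + 1 = Nat.find hex := by omega
    rw [not_lt, h2] at this
    exact this

/-- **Lemma 2.10 at a point of maximal height, one sign**: if `Im z ≥ Im γz` for all `γ ∈ Γ`,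
then for each sign the number of high rows `(c, d)`, `± c > 0`, is at most `18/Y`
(sum of the dyadic block counts `9 · 2^k (y/Y)^{1/2}` over `2^k < (yY)^{-1/2}`).
[cite: Iwaniec2002, Lemma 2.10 & proof, PDF pp. 38–39] -/
theorem ncard_signedHighRows_le
    (hΓ : Γ ≤ (Matrix.SpecialLinearGroup.toGL : SL(2, ℝ) →* GL (Fin 2) ℝ).range)
    (hd : IsDiscreteSubgroup Γ) (hT : Matrix.GeneralLinearGroup.upperRightHom (1 : ℝ) ∈ Γ)
    {z : ℍ} (hzmax : ∀ r ∈ rows Γ, rowIm r z ≤ z.im) {Y : ℝ} (hY : 0 < Y) (s : ℝ) :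
    (signedHighRows Γ z Y s).Finite ∧ ((signedHighRows Γ z Y s).ncard : ℝ) ≤ 18 / Y := by
  classical
  have hfinH := finite_highRows hΓ hd hT z hY
  have hfin : (signedHighRows Γ z Y s).Finite := hfinH.subset fun r hr => hr.1
  refine ⟨hfin, ?_⟩
  rcases (signedHighRows Γ z Y s).eq_empty_or_nonempty with he | ⟨r₁, hr₁⟩
  · rw [he, Set.ncard_empty]; simp; positivity
  -- `y > Y`
  have hy : 0 < z.im := z.im_pos
  have hyY : Y < z.im := hr₁.1.2.trans_le (hzmax r₁ hr₁.1.1)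
  set A : ℝ := Real.sqrt (z.im / Y) with hA
  have hA1 : 1 ≤ A := by
    rw [hA, Real.le_sqrt (by norm_num) (by positivity), one_pow, le_div_iff₀ hY]; linarith
  -- the number of blocks
  have hexK : ∃ K : ℕ, 1 / (z.im * Y) ≤ (4 : ℝ) ^ K :=
    let ⟨K, hK⟩ := pow_unbounded_of_one_lt (1 / (z.im * Y)) (by norm_num : (1 : ℝ) < 4)
    ⟨K, hK.le⟩
  set K : ℕ := Nat.find hexK with hK
  have hKspec : 1 / (z.im * Y) ≤ (4 : ℝ) ^ K := Nat.find_spec hexK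
  -- every signed high row is in a block `k < K`
  have hcover : hfin.toFinset ⊆ (Finset.range K).biUnion fun k =>
      (ncard_block_le hΓ hd hT z hY s k).1.toFinset := by
    intro r hr
    rw [Set.Finite.mem_toFinset] at hr
    obtain ⟨k, hk⟩ := exists_mem_block hΓ hd hT hr
    simp only [Finset.mem_biUnion, Finset.mem_range, Set.Finite.mem_toFinset]
    refine ⟨k, ?_, hk⟩
    obtain ⟨-, hc2, -⟩ := sq_lt_of_mem_highRows hY hr.1
    have h1 : ((2 : ℝ) ^ k) ^ 2 < (4 : ℝ) ^ K := by
      calc ((2 : ℝ) ^ k) ^ 2 ≤ |r 0| ^ 2 := pow_le_pow_left₀ (by positivity) hk.2.1 2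
        _ = (r 0) ^ 2 := sq_abs _
        _ < 1 / (z.im * Y) := hc2
        _ ≤ (4 : ℝ) ^ K := hKspec
    have h2 : ((2 : ℝ) ^ k) ^ 2 = (4 : ℝ) ^ k := by rw [← pow_mul, mul_comm, pow_mul]; norm_num
    rw [h2] at h1
    exact (pow_lt_pow_iff_right₀ (by norm_num : (1 : ℝ) < 4)).mp h1
  have hcardN : (signedHighRows Γ z Y s).ncard ≤ ∑ k ∈ Finset.range K, (block Γ z Y s k).ncard := by
    rw [Set.ncard_eq_toFinset_card _ hfin]
    refine (Finset.card_le_card hcover).trans (Finset.card_biUnion_le.trans ?_)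
    refine Finset.sum_le_sum fun k _ => ?_
    exact (Set.ncard_eq_toFinset_card _ (ncard_block_le hΓ hd hT z hY s k).1).ge
  have hcard : ((signedHighRows Γ z Y s).ncard : ℝ) ≤
      ∑ k ∈ Finset.range K, (((block Γ z Y s k).ncard : ℕ) : ℝ) := by
    exact_mod_cast hcardN
  refine hcard.trans ?_
  -- sum the block bounds
  have hblock : ∀ k ∈ Finset.range K, (((block Γ z Y s k).ncard : ℕ) : ℝ) ≤ 9 * A * (2 : ℝ) ^ k := by
    intro k _
    have h1 := (ncard_block_le hΓ hd hT z hY s k).2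
    have h2 : (1 : ℝ) ≤ (2 : ℝ) ^ k * A := by
      have : (1 : ℝ) ≤ (2 : ℝ) ^ k := one_le_pow₀ one_le_two
      nlinarith
    rw [← hA] at h1
    linarith
  refine (Finset.sum_le_sum hblock).trans ?_
  rw [← Finset.mul_sum, geom_sum_eq (by norm_num : (2 : ℝ) ≠ 1)]
  -- `9 A (2^K - 1) ≤ 18 / Y`
  rcases Nat.eq_zero_or_pos K with hK0 | hKpos
  · rw [hK0]; simp; positivity
  · have hKmin : (4 : ℝ) ^ (K - 1) < 1 / (z.im * Y) := by
      have := Nat.find_min hexK (m := K - 1) (by rw [hK]; exact Nat.sub_lt hKpos one_pos)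
      rwa [not_le] at this
    have h4K : (4 : ℝ) ^ K < 4 / (z.im * Y) := by
      have : (4 : ℝ) ^ K = 4 * (4 : ℝ) ^ (K - 1) := by
        rw [← pow_succ', Nat.sub_add_cancel hKpos]
      rw [this, show (4 : ℝ) / (z.im * Y) = 4 * (1 / (z.im * Y)) by ring]
      linarith
    -- `(A 2^K)^2 < (2/Y)^2`
    have hsq : (A * (2 : ℝ) ^ K) ^ 2 < (2 / Y) ^ 2 := by
      rw [mul_pow, hA, Real.sq_sqrt (by positivity),
        show ((2 : ℝ) ^ K) ^ 2 = (4 : ℝ) ^ K by rw [← pow_mul, mul_comm, pow_mul]; norm_num]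
      calc z.im / Y * (4 : ℝ) ^ K < z.im / Y * (4 / (z.im * Y)) := by gcongr
        _ = (2 / Y) ^ 2 := by field_simp; ring
    have hlt : A * (2 : ℝ) ^ K < 2 / Y := lt_of_pow_lt_pow_left₀ 2 (by positivity) hsq
    have hA0 : 0 ≤ A := by positivity
    calc 9 * A * (((2 : ℝ) ^ K - 1) / (2 - 1)) = 9 * (A * (2 : ℝ) ^ K) - 9 * A := by ring
      _ ≤ 9 * (2 / Y) - 0 := by gcongr; positivity
      _ = 18 / Y := by ring

/-- The high rows with `c = 0` are among `(0, ±1)`. [folklore] -/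
theorem ncard_highRows_zero_le
    (hΓ : Γ ≤ (Matrix.SpecialLinearGroup.toGL : SL(2, ℝ) →* GL (Fin 2) ℝ).range)
    (hd : IsDiscreteSubgroup Γ) (hT : Matrix.GeneralLinearGroup.upperRightHom (1 : ℝ) ∈ Γ)
    (z : ℍ) (Y : ℝ) :
    {r | r ∈ highRows Γ z Y ∧ r 0 = 0}.Finite ∧ {r | r ∈ highRows Γ z Y ∧ r 0 = 0}.ncard ≤ 2 := by
  have hsub : {r | r ∈ highRows Γ z Y ∧ r 0 = 0} ⊆ ({![(0 : ℝ), 1], ![(0 : ℝ), -1]} : Set (Fin 2 → ℝ)) := by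
    rintro r ⟨hr, h0⟩
    rcases apply_one_eq_of_mem_rows hΓ hd hT hr.1 h0 with h1 | h1
    · left; ext j; fin_cases j <;> simp [h0, h1]
    · right; ext j; fin_cases j <;> simp [h0, h1]
  have hfin : ({![(0 : ℝ), 1], ![(0 : ℝ), -1]} : Set (Fin 2 → ℝ)).Finite := Set.toFinite _
  refine ⟨hfin.subset hsub, (Set.ncard_le_ncard hsub hfin).trans ?_⟩
  exact (Set.ncard_insert_le _ _).trans (by rw [Set.ncard_singleton])

/-- **Lemma 2.10 at a point of maximal height.** [cite: Iwaniec2002, Lemma 2.10, PDF pp. 38–39] -/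
theorem ncard_highRows_le_of_maximal
    (hΓ : Γ ≤ (Matrix.SpecialLinearGroup.toGL : SL(2, ℝ) →* GL (Fin 2) ℝ).range)
    (hd : IsDiscreteSubgroup Γ) (hT : Matrix.GeneralLinearGroup.upperRightHom (1 : ℝ) ∈ Γ)
    {z : ℍ} (hzmax : ∀ r ∈ rows Γ, rowIm r z ≤ z.im) {Y : ℝ} (hY : 0 < Y) :
    ((highRows Γ z Y).ncard : ℝ) ≤ 2 + 36 / Y := by
  have h0 := ncard_highRows_zero_le hΓ hd hT z Y
  have hp := ncard_signedHighRows_le hΓ hd hT hzmax hY 1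
  have hm := ncard_signedHighRows_le hΓ hd hT hzmax hY (-1)
  set N : Set (Fin 2 → ℝ) := {r | r ∈ highRows Γ z Y ∧ r 0 = 0} with hN
  set P : Set (Fin 2 → ℝ) := signedHighRows Γ z Y 1 with hP
  set M : Set (Fin 2 → ℝ) := signedHighRows Γ z Y (-1) with hM
  have hcover : highRows Γ z Y ⊆ N ∪ (P ∪ M) := by
    intro r hr
    rcases lt_trichotomy (r 0) 0 with h | h | h
    · right; right; exact ⟨hr, by linarith⟩
    · left; exact ⟨hr, h⟩
    · right; left; exact ⟨hr, by linarith⟩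
  have hfinU := h0.1.union (hp.1.union hm.1)
  have h1 := Set.ncard_le_ncard hcover hfinU
  have h2 := Set.ncard_union_le N (P ∪ M)
  have h3 := Set.ncard_union_le P M
  have h123 : (highRows Γ z Y).ncard ≤ N.ncard + P.ncard + M.ncard :=
    h1.trans (h2.trans (by rw [add_assoc]; exact Nat.add_le_add_left h3 _))
  have h4 : ((highRows Γ z Y).ncard : ℝ) ≤ (N.ncard : ℝ) + (P.ncard : ℝ) + (M.ncard : ℝ) := by
    exact_mod_cast h123
  have h5 : (N.ncard : ℝ) ≤ 2 := by exact_mod_cast h0.2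
  have h6 : (36 : ℝ) / Y = 18 / Y + 18 / Y := by ring
  linarith [hp.2, hm.2]

/-- **Iwaniec, Lemma 2.10 (width-one normalisation, polygon-free form).** Let `Γ ≤ SL₂(ℝ)`
(inside `GL₂(ℝ)`) be discrete with `T = (1 1; 0 1) ∈ Γ` (the cusp `∞` scaled to width one,
as for `σ_𝔞⁻¹ Γ σ_𝔞` in (2.1)). Then for every `z ∈ ℍ` and `Y > 0` the set of bottom rows
`(c, d)` of `Γ` with `Im γz = y/|cz + d|² > Y` is finite and has at most `2 + 36/Y` elements;
since rows modulo `±` are the cosets `Γ_∞ γ` (when `-1 ∈ Γ`), this is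
`#{γ ∈ Γ_∞ \\ Γ : Im γz > Y} ≤ 1 + 18/Y`. Printed: `< 1 + 10/(c_∞ Y)` with `c_∞ ≥ 1` the least
positive lower-left entry (our constant is weaker; `c_∞ ≥ 1` is Shimizu's lemma
`one_le_abs_of_mem_rows`). The proof follows the book (spacing (2.34) of the points `d/c` and
dyadic ranges of `c`) at a point of maximal height of the orbit (`exists_smul_maximal`) instead
of a point of the standard polygon, the count being orbit-invariant (`ncard_highRows_smul`).
[cite: Iwaniec2002, Lemma 2.10 (2.39), PDF pp. 38–39] -/
theorem ncard_highRows_le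
    (hΓ : Γ ≤ (Matrix.SpecialLinearGroup.toGL : SL(2, ℝ) →* GL (Fin 2) ℝ).range)
    (hd : IsDiscreteSubgroup Γ) (hT : Matrix.GeneralLinearGroup.upperRightHom (1 : ℝ) ∈ Γ)
    (z : ℍ) {Y : ℝ} (hY : 0 < Y) :
    (highRows Γ z Y).Finite ∧ ((highRows Γ z Y).ncard : ℝ) ≤ 2 + 36 / Y := by
  refine ⟨finite_highRows hΓ hd hT z hY, ?_⟩
  obtain ⟨γ₀, hγ₀, hmax⟩ := exists_smul_maximal hΓ hd hT z
  rw [← ncard_highRows_smul hΓ hγ₀ z Y]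
  exact ncard_highRows_le_of_maximal hΓ hd hT hmax hY

end Counting2

/-! ## 6. Convergence of `Σ_{Γ_∞ \ Γ} (Im γz)^σ` for `σ > 1` -/

section Summability

/-- The heights at `z` are bounded: `Im γz ≤ H = y_max(z)` for all `γ ∈ Γ`. [cite: Iwaniec2002, (2.42)–(2.43), PDF pp. 39–40] -/
theorem exists_forall_rowIm_le
    (hΓ : Γ ≤ (Matrix.SpecialLinearGroup.toGL : SL(2, ℝ) →* GL (Fin 2) ℝ).range)
    (hd : IsDiscreteSubgroup Γ) (hT : Matrix.GeneralLinearGroup.upperRightHom (1 : ℝ) ∈ Γ) (z : ℍ) :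
    ∃ H : ℝ, z.im ≤ H ∧ ∀ r ∈ rows Γ, rowIm r z ≤ H := by
  obtain ⟨γ₀, hγ₀, hmax⟩ := exists_smul_maximal hΓ hd hT z
  refine ⟨(γ₀ • z).im, ?_, fun r hr => ?_⟩
  · have := hmax _ (row_mem_rows (Γ.inv_mem hγ₀))
    rwa [← im_smul_eq_rowIm (hΓ (Γ.inv_mem hγ₀)), ← mul_smul, inv_mul_cancel, one_smul] at this
  · have := hmax _ (vecMul_mem_rows hr (Γ.inv_mem hγ₀))
    rwa [rowIm_vecMul (hΓ (Γ.inv_mem hγ₀)), ← mul_smul, inv_mul_cancel, one_smul] at this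

/-- `(H / 2^j)^σ = H^σ · (2^{-σ})^j`. [folklore] -/
theorem div_two_pow_rpow {H : ℝ} (hH : 0 ≤ H) (σ : ℝ) (j : ℕ) :
    (H / (2 : ℝ) ^ j) ^ σ = H ^ σ * ((2 : ℝ) ^ (-σ)) ^ j := by
  rw [Real.div_rpow hH (by positivity), ← Real.rpow_natCast ((2 : ℝ) ^ (-σ)) j,
    ← Real.rpow_mul (by norm_num), ← Real.rpow_natCast (2 : ℝ) j, ← Real.rpow_mul (by norm_num),
    show -σ * (j : ℝ) = -((j : ℝ) * σ) by ring, Real.rpow_neg (by norm_num), div_eq_mul_inv]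

/-- **Uniform bound for the partial sums of `Σ (Im γz)^σ`** over bottom rows, `σ > 1`: with
`H ≥ Im γz` for all `γ` (e.g. `H = y_Γ(z)`), `q = 2^{-σ}`,
`Σ_{r ∈ T} (Im_r z)^σ ≤ 2H^σ/(1 - q) + 72 (H^σ/H)/(1 - 2q)` for every finite set `T` of rows
(dyadic shells in the height and Lemma 2.10 in each shell). [cite: Iwaniec2002, Lemma 2.10 & §3.1–3.2 (convergence of (3.1), (3.11) for `Re s > 1`), PDF pp. 38–43] -/
theorem sum_rowIm_rpow_le
    (hΓ : Γ ≤ (Matrix.SpecialLinearGroup.toGL : SL(2, ℝ) →* GL (Fin 2) ℝ).range)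
    (hd : IsDiscreteSubgroup Γ) (hT : Matrix.GeneralLinearGroup.upperRightHom (1 : ℝ) ∈ Γ)
    (z : ℍ) {σ : ℝ} (hσ : 1 < σ) {H : ℝ} (hH : 0 < H) (hmax : ∀ r ∈ rows Γ, rowIm r z ≤ H)
    (T : Finset (rows Γ)) :
    ∑ r ∈ T, (rowIm r.1 z) ^ σ ≤
      2 * H ^ σ * (1 - (2 : ℝ) ^ (-σ))⁻¹ + 72 * (H ^ σ / H) * (1 - 2 * (2 : ℝ) ^ (-σ))⁻¹ := by
  classical
  set q : ℝ := (2 : ℝ) ^ (-σ) with hq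
  have hq0 : 0 ≤ q := by positivity
  have hq1 : q < 1 := Real.rpow_lt_one_of_one_lt_of_neg one_lt_two (by linarith)
  have h2q0 : 0 ≤ 2 * q := by positivity
  have h2q1 : 2 * q < 1 := by
    have : 2 * q = (2 : ℝ) ^ (1 - σ) := by
      rw [hq, Real.rpow_sub (by norm_num), Real.rpow_one, Real.rpow_neg (by norm_num), div_eq_mul_inv]
    rw [this]
    exact Real.rpow_lt_one_of_one_lt_of_neg one_lt_two (by linarith)
  have hHσ : 0 ≤ H ^ σ := by positivity
  -- the shell bound `a j`
  set a : ℕ → ℝ := fun j => 2 * H ^ σ * q ^ j + 72 * (H ^ σ / H) * (2 * q) ^ j with ha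
  have ha0 : ∀ j, 0 ≤ a j := fun j => by positivity
  have hsum : Summable a :=
    ((summable_geometric_of_lt_one hq0 hq1).mul_left _).add
      ((summable_geometric_of_lt_one h2q0 h2q1).mul_left _)
  have htsum : ∑' j, a j = 2 * H ^ σ * (1 - q)⁻¹ + 72 * (H ^ σ / H) * (1 - 2 * q)⁻¹ := by
    rw [ha, ((summable_geometric_of_lt_one hq0 hq1).mul_left _).tsum_add
      ((summable_geometric_of_lt_one h2q0 h2q1).mul_left _), tsum_mul_left, tsum_mul_left,
      tsum_geometric_of_lt_one hq0 hq1, tsum_geometric_of_lt_one h2q0 h2q1]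
  rw [← htsum]
  -- the shell index
  have hex : ∀ r : rows Γ, ∃ j : ℕ, H / (2 : ℝ) ^ (j + 1) < rowIm r.1 z := by
    intro r
    have hpos : 0 < rowIm r.1 z := rowIm_pos (ne_zero_of_mem_rows r.2) z
    obtain ⟨j, hj⟩ := pow_unbounded_of_one_lt (H / rowIm r.1 z) (one_lt_two (α := ℝ))
    refine ⟨j, ?_⟩
    rw [div_lt_iff₀ (by positivity)]
    rw [div_lt_iff₀ hpos] at hj
    calc H < 2 ^ j * rowIm r.1 z := hj
      _ ≤ rowIm r.1 z * 2 ^ (j + 1) := by rw [mul_comm, pow_succ]; nlinarith [hpos]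
  set J : rows Γ → ℕ := fun r => Nat.find (hex r) with hJ
  have hJlow : ∀ r : rows Γ, H / (2 : ℝ) ^ (J r + 1) < rowIm r.1 z := fun r => Nat.find_spec (hex r)
  have hJup : ∀ r : rows Γ, rowIm r.1 z ≤ H / (2 : ℝ) ^ (J r) := by
    intro r
    rcases Nat.eq_zero_or_pos (J r) with h0 | hpos
    · rw [h0, pow_zero, div_one]; exact hmax r.1 r.2
    · have := Nat.find_min (hex r) (m := J r - 1) (Nat.sub_lt hpos one_pos)
      have h2 : J r - 1 + 1 = J r := by omega
      rw [not_lt, h2] at this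
      exact this
  -- fibrewise
  rw [← Finset.sum_fiberwise_of_maps_to (g := J) (t := T.image J) (fun r hr => Finset.mem_image_of_mem J hr)]
  have hfib : ∀ j ∈ T.image J, ∑ r ∈ T with J r = j, (rowIm r.1 z) ^ σ ≤ a j := by
    intro j _
    have hfinj := finite_highRows hΓ hd hT z (Y := H / (2 : ℝ) ^ (j + 1)) (by positivity)
    -- each term is at most `(H/2^j)^σ`
    have hterm : ∀ r ∈ T.filter (fun r => J r = j), (rowIm r.1 z) ^ σ ≤ (H / (2 : ℝ) ^ j) ^ σ := by
      intro r hr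
      rw [Finset.mem_filter] at hr
      refine Real.rpow_le_rpow (rowIm_nonneg _ _) ?_ (by linarith)
      rw [← hr.2]; exact hJup r
    -- the number of terms is at most `#highRows (H/2^(j+1)) ≤ 2 + 36 · 2^(j+1)/H`
    have hcard : ((T.filter (fun r => J r = j)).card : ℝ) ≤ 2 + 36 / (H / (2 : ℝ) ^ (j + 1)) := by
      have h1 : (T.filter (fun r => J r = j)).card ≤ hfinj.toFinset.card := by
        refine Finset.card_le_card_of_injOn (fun r => r.1) (fun r hr => ?_) (fun r _ r' _ h => Subtype.ext h)
        rw [Finset.mem_coe, Finset.mem_filter] at hr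
        rw [Finset.mem_coe, Set.Finite.mem_toFinset]
        refine ⟨r.2, ?_⟩
        rw [← hr.2]; exact hJlow r
      rw [← Set.ncard_eq_toFinset_card _ hfinj] at h1
      exact le_trans (by exact_mod_cast h1) (ncard_highRows_le hΓ hd hT z (by positivity)).2
    calc ∑ r ∈ T with J r = j, (rowIm r.1 z) ^ σ
        ≤ ∑ r ∈ T with J r = j, (H / (2 : ℝ) ^ j) ^ σ := Finset.sum_le_sum hterm
      _ = ((T.filter (fun r => J r = j)).card : ℝ) * (H / (2 : ℝ) ^ j) ^ σ := by
          rw [Finset.sum_const, nsmul_eq_mul]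
      _ ≤ (2 + 36 / (H / (2 : ℝ) ^ (j + 1))) * (H / (2 : ℝ) ^ j) ^ σ := by
          gcongr
      _ = a j := by
          rw [ha, div_two_pow_rpow hH.le σ j]
          simp only
          rw [mul_pow, pow_succ]
          field_simp
          ring
  refine (Finset.sum_le_sum hfib).trans ?_
  exact hsum.sum_le_tsum _ (fun j _ => ha0 j)

/-- **Convergence of the Eisenstein-type series** `Σ_{rows (c,d) of Γ} (y/|cz+d|²)^σ` for `σ > 1`
— i.e. of `E_∞(z, σ) = Σ_{γ ∈ Γ_∞ \\ Γ} (Im γz)^σ` and of the Poincaré series (3.1) with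
`|p(z)| ≪ y^σ` — for a discrete `Γ ≤ SL₂(ℝ)` with the cusp `∞` of width one.
[cite: Iwaniec2002, §3.1 (3.1) & §3.2 (3.11) ("absolutely convergent in `Re s > 1`"), PDF pp. 40–43; Lemma 2.10, PDF p. 38] -/
theorem summable_rowIm_rpow
    (hΓ : Γ ≤ (Matrix.SpecialLinearGroup.toGL : SL(2, ℝ) →* GL (Fin 2) ℝ).range)
    (hd : IsDiscreteSubgroup Γ) (hT : Matrix.GeneralLinearGroup.upperRightHom (1 : ℝ) ∈ Γ)
    (z : ℍ) {σ : ℝ} (hσ : 1 < σ) :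
    Summable fun r : rows Γ => (rowIm r.1 z) ^ σ := by
  obtain ⟨H, hzH, hmax⟩ := exists_forall_rowIm_le hΓ hd hT z
  have hH : 0 < H := z.im_pos.trans_le hzH
  exact summable_of_sum_le (fun r => Real.rpow_nonneg (rowIm_nonneg _ _) σ)
    (sum_rowIm_rpow_le hΓ hd hT z hσ hH hmax)

end Summability

/-! ## 7. Conjugation and scaling matrices -/

section Scaling

open scoped Pointwise

/-- Discreteness through bounded entries. [cite: Iwaniec2002, §2.1, PDF p. 27] -/
theorem isDiscreteSubgroup_iff_finite_abs_le :
    IsDiscreteSubgroup Γ ↔ ∀ R : ℝ, {γ : GL (Fin 2) ℝ | γ ∈ Γ ∧ ∀ i j, |(γ i j : ℝ)| ≤ R}.Finite := by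
  constructor
  · intro hd R
    refine (hd (4 * R ^ 2)).subset ?_
    rintro γ ⟨hγ, hR⟩
    refine ⟨hγ, ?_⟩
    have h := fun i j => (sq_abs (γ i j : ℝ)).symm.trans_le (pow_le_pow_left₀ (abs_nonneg _) (hR i j) 2)
    linarith [h 0 0, h 0 1, h 1 0, h 1 1]
  · intro h r
    refine (h (Real.sqrt r)).subset ?_
    rintro γ ⟨hγ, hr⟩
    refine ⟨hγ, fun i j => ?_⟩
    rw [← Real.sqrt_sq_eq_abs]
    apply Real.sqrt_le_sqrt
    fin_cases i <;> fin_cases j <;> simp <;>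
      nlinarith [sq_nonneg (γ 0 0 : ℝ), sq_nonneg (γ 0 1 : ℝ), sq_nonneg (γ 1 0 : ℝ), sq_nonneg (γ 1 1 : ℝ)]

/-- Entries of a product of `2 × 2` matrices with bounded entries. [folklore] -/
theorem abs_mul_apply_le {A B : Matrix (Fin 2) (Fin 2) ℝ} {a b : ℝ} (hA : ∀ i j, |A i j| ≤ a)
    (hB : ∀ i j, |B i j| ≤ b) (i j : Fin 2) : |(A * B) i j| ≤ 2 * a * b := by
  have ha : 0 ≤ a := (abs_nonneg _).trans (hA 0 0)
  rw [Matrix.mul_apply, Fin.sum_univ_two]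
  calc |A i 0 * B 0 j + A i 1 * B 1 j| ≤ |A i 0| * |B 0 j| + |A i 1| * |B 1 j| := by
        rw [← abs_mul, ← abs_mul]; exact abs_add_le _ _
    _ ≤ a * b + a * b := by
        gcongr <;> first | exact ha | exact hA _ _ | exact hB _ _
    _ = 2 * a * b := by ring

/-- **Discreteness is invariant under conjugation** in `GL₂(ℝ)`. [cite: Iwaniec2002, §2.1 & (2.1) ("conjugating the group"), PDF pp. 27, 30, 38] -/
theorem _root_.Literature.NumberTheory.Automorphic.IsDiscreteSubgroup.conj (hd : IsDiscreteSubgroup Γ)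
    (σ : GL (Fin 2) ℝ) : IsDiscreteSubgroup (ConjAct.toConjAct σ • Γ) := by
  rw [isDiscreteSubgroup_iff_finite_abs_le] at hd ⊢
  intro R
  -- bounds for the entries of `σ⁻¹` and `σ`
  set a : ℝ := max (max |((σ⁻¹ : GL (Fin 2) ℝ) 0 0 : ℝ)| |((σ⁻¹ : GL (Fin 2) ℝ) 0 1 : ℝ)|)
    (max |((σ⁻¹ : GL (Fin 2) ℝ) 1 0 : ℝ)| |((σ⁻¹ : GL (Fin 2) ℝ) 1 1 : ℝ)|) with ha
  set c : ℝ := max (max |(σ 0 0 : ℝ)| |(σ 0 1 : ℝ)|) (max |(σ 1 0 : ℝ)| |(σ 1 1 : ℝ)|) with hc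
  have hσi : ∀ i j, |(((σ⁻¹ : GL (Fin 2) ℝ)) : Matrix (Fin 2) (Fin 2) ℝ) i j| ≤ a := by
    intro i j; fin_cases i <;> fin_cases j
    · exact (le_max_left _ _).trans (le_max_left _ _)
    · exact (le_max_right _ _).trans (le_max_left _ _)
    · exact (le_max_left _ _).trans (le_max_right _ _)
    · exact (le_max_right _ _).trans (le_max_right _ _)
  have hσ : ∀ i j, |((σ : GL (Fin 2) ℝ) : Matrix (Fin 2) (Fin 2) ℝ) i j| ≤ c := by
    intro i j; fin_cases i <;> fin_cases j
    · exact (le_max_left _ _).trans (le_max_left _ _)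
    · exact (le_max_right _ _).trans (le_max_left _ _)
    · exact (le_max_left _ _).trans (le_max_right _ _)
    · exact (le_max_right _ _).trans (le_max_right _ _)
  refine ((hd (2 * (2 * a * R) * c)).image fun γ => σ * γ * σ⁻¹).subset ?_
  rintro δ ⟨hδ, hR⟩
  rw [Subgroup.mem_pointwise_smul_iff_inv_smul_mem, ← ConjAct.toConjAct_inv,
    ConjAct.toConjAct_smul, inv_inv] at hδ
  refine ⟨σ⁻¹ * δ * σ, ⟨hδ, fun i j => ?_⟩, by group⟩
  have h1 : ∀ i j, |((((σ⁻¹ : GL (Fin 2) ℝ)) : Matrix (Fin 2) (Fin 2) ℝ) *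
      ((δ : GL (Fin 2) ℝ) : Matrix (Fin 2) (Fin 2) ℝ)) i j| ≤ 2 * a * R :=
    abs_mul_apply_le hσi (fun i j => hR i j)
  have h2 := abs_mul_apply_le h1 hσ i j
  simpa only [Units.val_mul] using h2

/-- Conjugates of subgroups of `SL₂(ℝ)` by elements of `SL₂(ℝ)` stay inside `SL₂(ℝ)`. [folklore] -/
theorem conj_le_range
    (hΓ : Γ ≤ (Matrix.SpecialLinearGroup.toGL : SL(2, ℝ) →* GL (Fin 2) ℝ).range) (σ : SL(2, ℝ)) :
    ConjAct.toConjAct (Matrix.SpecialLinearGroup.toGL σ : GL (Fin 2) ℝ) • Γ ≤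
      (Matrix.SpecialLinearGroup.toGL : SL(2, ℝ) →* GL (Fin 2) ℝ).range := by
  intro δ hδ
  rw [Subgroup.mem_pointwise_smul_iff_inv_smul_mem, ← ConjAct.toConjAct_inv,
    ConjAct.toConjAct_smul, inv_inv] at hδ
  obtain ⟨g, hg⟩ := hΓ hδ
  refine ⟨σ * g * σ⁻¹, ?_⟩
  rw [map_mul, map_mul, map_inv, hg]
  group

/-- Membership in the conjugate `σ⁻¹ Γ σ`. [folklore] -/
theorem mem_conj_inv_iff (σ δ : GL (Fin 2) ℝ) :
    δ ∈ ConjAct.toConjAct σ⁻¹ • Γ ↔ σ * δ * σ⁻¹ ∈ Γ := by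
  rw [Subgroup.mem_pointwise_smul_iff_inv_smul_mem, ← ConjAct.toConjAct_inv, inv_inv,
    ConjAct.toConjAct_smul]

/-- `-1` is central, so it survives conjugation. [folklore] -/
theorem neg_one_mem_conj_iff (σ : GL (Fin 2) ℝ) : -1 ∈ ConjAct.toConjAct σ • Γ ↔ -1 ∈ Γ := by
  rw [Subgroup.mem_pointwise_smul_iff_inv_smul_mem, ← ConjAct.toConjAct_inv, ConjAct.toConjAct_smul]
  simp

end Scaling

section Scaling2

open scoped Pointwise

/-- Over `ℝ`, `mapGL ℝ = toGL`. [folklore] -/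
theorem mapGL_real (g : SL(2, ℝ)) :
    Matrix.SpecialLinearGroup.mapGL ℝ g = (Matrix.SpecialLinearGroup.toGL g : GL (Fin 2) ℝ) := by
  ext i j
  simp [Matrix.SpecialLinearGroup.mapGL]

/-- Iterated conjugation: `(στ)⁻¹ Γ (στ) = τ⁻¹ (σ⁻¹ Γ σ) τ`. [folklore] -/
theorem conj_inv_mul (σ τ : GL (Fin 2) ℝ) :
    ConjAct.toConjAct (σ * τ)⁻¹ • Γ = ConjAct.toConjAct τ⁻¹ • (ConjAct.toConjAct σ⁻¹ • Γ) := by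
  rw [_root_.mul_inv_rev, map_mul, mul_smul]

/-- **Existence of scaling matrices** (Iwaniec (2.1)). Let `Γ ≤ SL₂(ℝ)` (inside `GL₂(ℝ)`) be
discrete and `𝔞` a cusp of `Γ`. Then there is `σ_𝔞 ∈ SL₂(ℝ)` with `σ_𝔞 ∞ = 𝔞` such that the
conjugate `Γ' = σ_𝔞⁻¹ Γ σ_𝔞` has the cusp `∞` of width exactly one: its periods are `ℤ`, so
`(1 1; 0 1) ∈ Γ'` and (by `mem_and_apply_10_eq_zero_iff`, when `-1 ∈ Γ`)
`σ_𝔞⁻¹ Γ_𝔞 σ_𝔞 = Γ'_∞ = B = {±(1 n; 0 1)}`; moreover `Γ'` is again discrete and inside `SL₂(ℝ)`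
(`IsDiscreteSubgroup.conj`, `conj_le_range`), so §§4–6 apply to `Γ'`.
[cite: Iwaniec2002, §2.2 (2.1), PDF p. 30; §2.4, PDF p. 34] -/
theorem exists_scaling
    (hΓ : Γ ≤ (Matrix.SpecialLinearGroup.toGL : SL(2, ℝ) →* GL (Fin 2) ℝ).range)
    (hd : IsDiscreteSubgroup Γ) {𝔞 : OnePoint ℝ} (h𝔞 : IsCusp 𝔞 Γ) :
    ∃ σ : SL(2, ℝ), (Matrix.SpecialLinearGroup.toGL σ : GL (Fin 2) ℝ) • OnePoint.infty = 𝔞 ∧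
      (ConjAct.toConjAct (Matrix.SpecialLinearGroup.toGL σ : GL (Fin 2) ℝ)⁻¹ • Γ).strictPeriods =
        AddSubgroup.zmultiples 1 ∧
      Matrix.GeneralLinearGroup.upperRightHom 1 ∈
        ConjAct.toConjAct (Matrix.SpecialLinearGroup.toGL σ : GL (Fin 2) ℝ)⁻¹ • Γ := by
  classical
  obtain ⟨g₀, hg₀⟩ := OnePoint.exists_mem_SL2 ℝ 𝔞
  rw [mapGL_real] at hg₀
  set G₀ : GL (Fin 2) ℝ := Matrix.SpecialLinearGroup.toGL g₀ with hG₀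
  set Γ₁ : Subgroup (GL (Fin 2) ℝ) := ConjAct.toConjAct G₀⁻¹ • Γ with hΓ₁
  have h1 : IsCusp OnePoint.infty Γ₁ := by
    have := h𝔞.smul G₀⁻¹
    rwa [← hg₀, inv_smul_smul] at this
  have hΓ₁le : Γ₁ ≤ (Matrix.SpecialLinearGroup.toGL : SL(2, ℝ) →* GL (Fin 2) ℝ).range := by
    rw [hΓ₁, hG₀, ← map_inv]; exact conj_le_range hΓ g₀⁻¹
  have hd₁ : IsDiscreteSubgroup Γ₁ := hd.conj _
  set w : ℝ := Γ₁.strictWidthInfty with hw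
  have hw0 : 0 < w := strictWidthInfty_pos hΓ₁le hd₁ h1
  have hP : Γ₁.strictPeriods = AddSubgroup.zmultiples w := strictPeriods_eq_zmultiples hd₁
  have hsw : Real.sqrt w ≠ 0 := (Real.sqrt_pos.mpr hw0).ne'
  -- the tree's diagonal torus `diagSL2` (`RootData.lean`) at `√w`
  set D : SL(2, ℝ) := diagSL2 (Units.mk0 (Real.sqrt w) hsw) with hD
  have hD10 : D 1 0 = 0 := by rw [hD, coe_diagSL2]; rfl
  have hD00 : D 0 0 = Real.sqrt w := by rw [hD, coe_diagSL2]; rfl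
  refine ⟨g₀ * D, ?_, ?_, ?_⟩
  · rw [map_mul, mul_smul]
    have : (Matrix.SpecialLinearGroup.toGL D : GL (Fin 2) ℝ) • (OnePoint.infty : OnePoint ℝ) = OnePoint.infty := by
      rw [OnePoint.smul_infty_eq_self_iff]; exact hD10
    rw [this]; exact hg₀
  · -- the periods of `D⁻¹ Γ₁ D` are `w⁻¹ · (w ℤ) = ℤ`
    have key : ∀ x : ℝ, x ∈ (ConjAct.toConjAct (Matrix.SpecialLinearGroup.toGL (g₀ * D) : GL (Fin 2) ℝ)⁻¹ • Γ).strictPeriods ↔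
        w * x ∈ Γ₁.strictPeriods := by
      intro x
      rw [Subgroup.mem_strictPeriods_iff, Subgroup.mem_strictPeriods_iff, map_mul, conj_inv_mul,
        mem_conj_inv_iff, toGL_conj_upperRightHom hD10]
      rw [show (D 0 0) ^ 2 * x = w * x by rw [hD00, Real.sq_sqrt hw0.le]]
    ext x
    rw [key, hP, AddSubgroup.mem_zmultiples_iff, AddSubgroup.mem_zmultiples_iff]
    constructor
    · rintro ⟨n, hn⟩
      refine ⟨n, ?_⟩
      rw [zsmul_eq_mul] at hn ⊢
      rw [mul_one]
      have : (n : ℝ) * w = x * w := by rw [hn, mul_comm]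
      exact mul_right_cancel₀ hw0.ne' this
    · rintro ⟨n, rfl⟩
      exact ⟨n, by rw [zsmul_eq_mul, zsmul_eq_mul, mul_one, mul_comm]⟩
  · rw [← Subgroup.mem_strictPeriods_iff]
    have key1 : (1 : ℝ) ∈ (ConjAct.toConjAct (Matrix.SpecialLinearGroup.toGL (g₀ * D) : GL (Fin 2) ℝ)⁻¹ • Γ).strictPeriods ↔
        w * 1 ∈ Γ₁.strictPeriods := by
      rw [Subgroup.mem_strictPeriods_iff, Subgroup.mem_strictPeriods_iff, map_mul, conj_inv_mul,
        mem_conj_inv_iff, toGL_conj_upperRightHom hD10]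
      rw [show (D 0 0) ^ 2 * 1 = w * 1 by rw [hD00, Real.sq_sqrt hw0.le]]
    rw [key1, mul_one, hP]
    exact AddSubgroup.mem_zmultiples w

end Scaling2

end Fuchsian

end Literature.NumberTheory.Automorphic
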